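import Literature.Probability.RandomPlanarGeometry.SAWKestenPatterns
import Mathlib.Data.List.GetD
import HarnessLib

/-!
# Rewiring a self-avoiding walk inside a cube: a clean `(V, Q)`-route between boundary points

Topic `Literature/Probability/RandomPlanarGeometry`, infrastructure for Kesten's Pattern Theorem
(Madras–Slade, *The Self-Avoiding Walk* (1993), §7.2) in the vertex-function model of
`SAWCount.lean` / `SAWKestenPatterns.lean`, all dimensions `d + 2 ≥ 2`. The pattern theorem's
surgery (Lemma 7.2.4(b) and the proofs of Lemma 7.2.6, Theorem 7.2.3) replaces the piece of a
walk inside a cube, between its first entry point `x` and its last exit point `y` (two points of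
the outer layer), by a walk inside the cube from `x` to `y` on which a prescribed pattern occurs.
Madras–Slade route within the two outer layers of the cube ("one can find a self-avoiding walk …
simply avoid outer points until the very end"); we give instead an explicit construction that is
uniform in the dimension.

## Contents (namespace `Literature.Probability.RandomPlanarGeometry.SAW.Zd`; all PROVED)

* `PathOn L π` — `π(0), …, π(L)` is a self-avoiding nearest-neighbour path at absolute positions
  (`pathOn_of_mem_saws`, `mem_saws_of_pathOn`); `pappend` and `PathOn.append` (concatenation of
  pieces meeting only at the junction), `preverse` / `PathOn.reverse`, `PathOn.add_const`,
  `PathOn.mono`, `PathOn.shift`.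
* `gpath p q` — the **greedy coordinate path** (repeatedly move the least differing coordinate
  one unit toward `q`): `pathOn_gpath` (self-avoiding: the `ℓ¹` distance `dist1` to `q` drops by
  one each step, `dist1_gstep`), it reaches `q` at time `dist1 p q` and stays (`gpath_of_ge`),
  each coordinate stays between its endpoint values (`gpath_apply_mem`, `gpath_apply_of_eq`),
  exact levels for single-coordinate paths (`gpath_level_of_le/ge`).
* Three explicit planar **gadgets** `gadgetP` (axis `eᵢ`, `i ≥ 2`), `gadgetZ` (axis `e₀`),
  `gadgetN` (axis `e₁`), lists of lattice triples checked by `decide` (`gadget_checks`,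
  `gadget_specs`): each runs along the axis from level `gadgetLo i` to `gadgetHi i` with a bump
  spelling Kesten's pattern `V = N³ESENES³` (cleanly: no other gadget point in its cube `Q`) and a
  bump spelling `V` backwards; `listWalk`/`emb` turn lists into walks (`pathOn_listWalk`), giving
  the interface `pathOn_gadgetWalk` (G1), `gadgetWalk_zero/len` (G2), `gadgetWalk_ranges`
  (G3–G4), `gadget_occV` (G5), `gadget_occVrev` (G6).
* `routeUp i x y` (case `xᵢ < yᵢ`; cumulative walks `A1 … A7`, lengths `m1 … m7`): the segment
  from `x` down to the face `zᵢ = -13`, the greedy path in that face to its centre, the axis up to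
  the gadget, the gadget, the axis up to the top face centre, the greedy path in the top face, the
  segment down to `y`; `A7_spec` (self-avoiding, from `x` to `y`, inside the cube; the pieces are
  separated by their levels and transverse coordinates, the only delicate point being that a
  boundary point with small transverse coordinates has extreme level, `xi_eq_of_small`),
  `A7_occV`, `A7_occVrev` (the clean `V` / backward `V` on the route, `A7_avoid`), `m7_le`.
* `exists_route` — **the routing theorem**: for `x ≠ y` on the outer layer of
  `c + [-13,13]^{d+2}` a self-avoiding path inside the cube from `x` to `y`, of length
  `≤ 156 (d+2) + 56`, with a clean occurrence of `(V, Q)` whose cube lies in `c + [-12,12]^{d+2}`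
  (for `xᵢ > yᵢ` the reversed route from `y` to `x` is used, reading its backward `V` forwards,
  `occ_of_rev`).

## References

* N. Madras, G. Slade, *The Self-Avoiding Walk*, Birkhäuser (1993), §7.2, Lemma 7.2.4 and the
  proofs of Lemma 7.2.6 and Theorem 7.2.3 (replacement of the piece of a walk inside a cube).
-/

noncomputable section

open Filter Topology Literature.Probability.LatticeModels Literature.Probability.Percolation SimpleGraph
open scoped BigOperators

namespace Literature.Probability.RandomPlanarGeometry.SAW.Zd

/-! ### Self-avoiding pieces of walks at absolute positions -/

section PathOn

variable {D : ℕ}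

/-- `π(0), …, π(L)` is a self-avoiding nearest-neighbour path of `ℤ^D` (no condition on the
starting point or on the values after time `L`). [cite: MadrasSlade1993, §1.1] -/
def PathOn (L : ℕ) (π : ℕ → Site D) : Prop :=
  (∀ t < L, (zdGraph D).Adj (π t) (π (t + 1))) ∧ Set.InjOn π {t | t ≤ L}

/-- A walk of `saws` is a self-avoiding path on `[0, n]`. [folklore] -/
theorem pathOn_of_mem_saws {n : ℕ} {ω : ℕ → Site D} (h : ω ∈ saws D n) : PathOn n ω :=
  ⟨(mem_saws.1 h).2.2.1, (mem_saws.1 h).2.2.2⟩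

/-- A self-avoiding path from `0`, frozen after time `n`, is a walk of `saws`. [folklore] -/
theorem mem_saws_of_pathOn {n : ℕ} {ω : ℕ → Site D} (h : PathOn n ω) (h0 : ω 0 = 0)
    (hend : ∀ t, n ≤ t → ω t = ω n) : ω ∈ saws D n :=
  mem_saws.2 ⟨h0, hend, h.1, h.2⟩

/-- Restriction to a shorter time interval. [folklore] -/
theorem PathOn.mono {L L' : ℕ} {π : ℕ → Site D} (h : PathOn L π) (hL : L' ≤ L) : PathOn L' π :=
  ⟨fun t ht => h.1 t (by omega), fun s hs t ht hst => h.2 (show s ≤ L by simp at hs; omega)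
    (show t ≤ L by simp at ht; omega) hst⟩

/-- The piece of a path starting at time `k`. [folklore] -/
theorem PathOn.shift {L : ℕ} {π : ℕ → Site D} (h : PathOn L π) {k : ℕ} (hk : k ≤ L) :
    PathOn (L - k) (fun t => π (k + t)) := by
  refine ⟨fun t ht => ?_, fun s hs t ht hst => ?_⟩
  · simpa [add_assoc] using h.1 (k + t) (by omega)
  · simp only [Set.mem_setOf_eq] at hs ht
    have := h.2 (show k + s ≤ L by omega) (show k + t ≤ L by omega) hst
    omega

/-- Translates of self-avoiding paths are self-avoiding paths. [folklore] -/
theorem PathOn.add_const {L : ℕ} {π : ℕ → Site D} (h : PathOn L π) (c : Site D) :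
    PathOn L (fun t => c + π t) := by
  refine ⟨fun t ht => ?_, fun s hs t ht hst => h.2 hs ht (add_left_cancel hst)⟩
  show (zdGraph D).Adj (c + π t) (c + π (t + 1))
  rw [add_comm c, add_comm c, zdGraph_adj_add_right]
  exact h.1 t ht

/-- The time reversal `t ↦ π(L - t)` of a piece. [folklore] -/
def preverse (L : ℕ) (π : ℕ → Site D) : ℕ → Site D := fun t => π (L - t)

/-- The time reversal of a self-avoiding path is a self-avoiding path. [folklore] -/
theorem PathOn.reverse {L : ℕ} {π : ℕ → Site D} (h : PathOn L π) : PathOn L (preverse L π) := by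
  refine ⟨fun t ht => ?_, fun s hs t ht hst => ?_⟩
  · simp only [preverse]
    rw [show L - t = L - (t + 1) + 1 by omega]
    exact (h.1 (L - (t + 1)) (by omega)).symm
  · simp only [Set.mem_setOf_eq, preverse] at hs ht hst
    have := h.2 (show L - s ≤ L by omega) (show L - t ≤ L by omega) hst
    omega

/-- Concatenation of two pieces: `α` on `[0, m]`, then `β` (with `β(0) = α(m)`). [folklore] -/
def pappend (m : ℕ) (α β : ℕ → Site D) : ℕ → Site D := fun t => if t ≤ m then α t else β (t - m)

/-- Values of the concatenation on the first piece. [folklore] -/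
theorem pappend_of_le {m t : ℕ} (α β : ℕ → Site D) (h : t ≤ m) : pappend m α β t = α t := by
  simp [pappend, h]

/-- Values of the concatenation on the second piece. [folklore] -/
theorem pappend_add (m t : ℕ) (α β : ℕ → Site D) (hj : α m = β 0) :
    pappend m α β (m + t) = β t := by
  rcases Nat.eq_zero_or_pos t with rfl | ht
  · simp [pappend, hj]
  · simp [pappend, show ¬ m + t ≤ m by omega]

/-- **Concatenation of self-avoiding pieces that meet only at the junction is self-avoiding.**
[folklore] -/
theorem PathOn.append {m n : ℕ} {α β : ℕ → Site D} (hα : PathOn m α) (hβ : PathOn n β)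
    (hj : α m = β 0) (hdis : ∀ s < m, ∀ t, 1 ≤ t → t ≤ n → α s ≠ β t) :
    PathOn (m + n) (pappend m α β) := by
  have hdis' : ∀ s ≤ m, ∀ t, 1 ≤ t → t ≤ n → α s ≠ β t := by
    intro s hs t ht1 ht2
    rcases hs.lt_or_eq with hs' | rfl
    · exact hdis s hs' t ht1 ht2
    · rw [hj]
      intro h
      have := hβ.2 (show 0 ≤ n from Nat.zero_le n) (show t ≤ n from ht2) h
      omega
  refine ⟨fun t ht => ?_, fun s hs t ht hst => ?_⟩
  · rcases Nat.lt_or_ge t m with h | h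
    · rw [pappend_of_le α β h.le, pappend_of_le α β h]
      exact hα.1 t h
    · obtain ⟨k, rfl⟩ : ∃ k, t = m + k := ⟨t - m, by omega⟩
      rw [pappend_add m k α β hj, show m + k + 1 = m + (k + 1) by ring, pappend_add m (k + 1) α β hj]
      exact hβ.1 k (by omega)
  · simp only [Set.mem_setOf_eq] at hs ht
    rcases le_or_gt s m with h1 | h1 <;> rcases le_or_gt t m with h2 | h2
    · rw [pappend_of_le α β h1, pappend_of_le α β h2] at hst
      exact hα.2 (show s ≤ m from h1) (show t ≤ m from h2) hst
    · obtain ⟨k, rfl⟩ : ∃ k, t = m + k := ⟨t - m, by omega⟩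
      rw [pappend_of_le α β h1, pappend_add m k α β hj] at hst
      exact absurd hst (hdis' s h1 k (by omega) (by omega))
    · obtain ⟨k, rfl⟩ : ∃ k, s = m + k := ⟨s - m, by omega⟩
      rw [pappend_of_le α β h2, pappend_add m k α β hj] at hst
      exact absurd hst.symm (hdis' t h2 k (by omega) (by omega))
    · obtain ⟨k, rfl⟩ : ∃ k, s = m + k := ⟨s - m, by omega⟩
      obtain ⟨l, rfl⟩ : ∃ l, t = m + l := ⟨t - m, by omega⟩
      rw [pappend_add m k α β hj, pappend_add m l α β hj] at hst
      have := hβ.2 (show k ≤ n by omega) (show l ≤ n by omega) hst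
      omega

end PathOn

/-! ### Greedy coordinate paths -/

section Greedy

variable {D : ℕ}

/-- The `ℓ¹` distance on `ℤ^D` (as a natural number). [folklore] -/
def dist1 (z q : Site D) : ℕ := ∑ i, (q i - z i).natAbs

/-- `dist1 z q = 0 ↔ z = q`. [folklore] -/
theorem dist1_eq_zero {z q : Site D} : dist1 z q = 0 ↔ z = q := by
  unfold dist1
  rw [Finset.sum_eq_zero_iff]
  constructor
  · intro h; funext i; have := h i (Finset.mem_univ i); omega
  · rintro rfl i _; simp

open Classical in
/-- One greedy step from `z` toward `q`: the least coordinate in which `z` differs from `q` is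
moved by one toward `q`. [folklore] -/
def gstep (q z : Site D) : Site D :=
  if h : ∃ i, z i ≠ q i then
    Function.update z (Fin.find _ h)
      (z (Fin.find _ h) + Int.sign (q (Fin.find _ h) - z (Fin.find _ h)))
  else z

/-- The **greedy path** from `p` to `q`: repeatedly move the least differing coordinate toward
`q` (it reaches `q` after `dist1 p q` steps and stays there). [folklore] -/
def gpath (p q : Site D) : ℕ → Site D := fun t => (gstep q)^[t] p

/-- `gpath p q 0 = p`. [folklore] -/
@[simp] theorem gpath_zero (p q : Site D) : gpath p q 0 = p := rfl

/-- The recursion of the greedy path. [folklore] -/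
theorem gpath_succ (p q : Site D) (t : ℕ) : gpath p q (t + 1) = gstep q (gpath p q t) := by
  simp only [gpath]
  rw [Function.iterate_succ_apply']

/-- A greedy step from `q` itself does nothing. [folklore] -/
theorem gstep_self (q : Site D) : gstep q q = q := by
  unfold gstep; rw [dif_neg]; simp

/-- The shape of a greedy step away from the target: one coordinate `i` with `z i ≠ q i` moves by
`sign (q i - z i)`, the others are unchanged. [folklore] -/
theorem gstep_of_ne {q z : Site D} (h : z ≠ q) :
    ∃ i, z i ≠ q i ∧ gstep q z = Function.update z i (z i + Int.sign (q i - z i)) := by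
  classical
  have h' : ∃ i, z i ≠ q i := by
    by_contra hc; push Not at hc; exact h (funext hc)
  refine ⟨Fin.find _ h', Fin.find_spec h', ?_⟩
  unfold gstep
  rw [dif_pos h']

/-- A greedy step decreases the `ℓ¹` distance to the target by one. [folklore] -/
theorem dist1_gstep {q z : Site D} (h : z ≠ q) : dist1 (gstep q z) q + 1 = dist1 z q := by
  obtain ⟨i, hi, e⟩ := gstep_of_ne h
  rw [e]
  unfold dist1
  rw [← Finset.add_sum_erase _ _ (Finset.mem_univ i), ← Finset.add_sum_erase _ _ (Finset.mem_univ i)]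
  have hrest : ∑ x ∈ Finset.univ.erase i, (q x - Function.update z i (z i + (q i - z i).sign) x).natAbs =
      ∑ x ∈ Finset.univ.erase i, (q x - z x).natAbs := by
    refine Finset.sum_congr rfl fun j hj => ?_
    rw [Function.update_of_ne (Finset.ne_of_mem_erase hj)]
  rw [hrest, Function.update_self]
  have key : (q i - (z i + (q i - z i).sign)).natAbs + 1 = (q i - z i).natAbs := by
    rcases lt_trichotomy (q i - z i) 0 with hlt | heq | hgt
    · rw [Int.sign_eq_neg_one_of_neg hlt]; omega
    · exact absurd (sub_eq_zero.1 heq).symm hi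
    · rw [Int.sign_eq_one_of_pos hgt]; omega
  omega

/-- A greedy step away from the target is a nearest-neighbour step. [folklore] -/
theorem gstep_adj {q z : Site D} (h : z ≠ q) : (zdGraph D).Adj z (gstep q z) := by
  obtain ⟨i, hi, e⟩ := gstep_of_ne h
  rw [e, zdGraph_adj_iff]
  refine ⟨i, ?_⟩
  rcases lt_trichotomy (q i - z i) 0 with hlt | heq | hgt
  · right
    rw [Int.sign_eq_neg_one_of_neg hlt]
    funext j
    by_cases hj : j = i
    · subst hj; simp
    · simp [Function.update_of_ne hj, Pi.single_eq_of_ne hj]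
  · exact absurd (sub_eq_zero.1 heq).symm hi
  · left
    rw [Int.sign_eq_one_of_pos hgt]
    funext j
    by_cases hj : j = i
    · subst hj; simp
    · simp [Function.update_of_ne hj, Pi.single_eq_of_ne hj]

/-- The distance to the target along the greedy path. [folklore] -/
theorem dist1_gpath (p q : Site D) : ∀ t ≤ dist1 p q, dist1 (gpath p q t) q = dist1 p q - t := by
  intro t
  induction t with
  | zero => intro; simp
  | succ t ih =>
    intro ht
    have h1 := ih (by omega)
    have hne : gpath p q t ≠ q := by
      intro h; rw [← dist1_eq_zero] at h; omega
    have := dist1_gstep hne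
    rw [gpath_succ]; omega

/-- The greedy path reaches the target at time `dist1 p q` and stays there. [folklore] -/
theorem gpath_of_ge (p q : Site D) {t : ℕ} (ht : dist1 p q ≤ t) : gpath p q t = q := by
  obtain ⟨k, rfl⟩ : ∃ k, t = dist1 p q + k := ⟨t - dist1 p q, by omega⟩
  induction k with
  | zero =>
    have := dist1_gpath p q (dist1 p q) le_rfl
    simpa [dist1_eq_zero] using this
  | succ k ih =>
    rw [show dist1 p q + (k + 1) = dist1 p q + k + 1 by ring, gpath_succ, ih (by omega), gstep_self]

/-- **The greedy path is a self-avoiding nearest-neighbour path** (the `ℓ¹` distance to the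
target strictly decreases). [folklore] -/
theorem pathOn_gpath (p q : Site D) : PathOn (dist1 p q) (gpath p q) := by
  refine ⟨fun t ht => ?_, fun s hs t ht hst => ?_⟩
  · rw [gpath_succ]
    refine gstep_adj fun h => ?_
    have := dist1_gpath p q t ht.le
    rw [h, dist1_eq_zero.2 rfl] at this
    omega
  · simp only [Set.mem_setOf_eq] at hs ht
    have h1 := dist1_gpath p q s hs
    have h2 := dist1_gpath p q t ht
    rw [hst] at h1
    omega

/-- Each coordinate moves monotonically from `p i` to `q i`: it always lies between them.
[folklore] -/
theorem gpath_apply_mem (p q : Site D) (i : Fin D) (t : ℕ) :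
    min (p i) (q i) ≤ gpath p q t i ∧ gpath p q t i ≤ max (p i) (q i) := by
  induction t with
  | zero => simp
  | succ t ih =>
    rw [gpath_succ]
    by_cases h : gpath p q t = q
    · rw [h, gstep_self]; exact ⟨min_le_right _ _, le_max_right _ _⟩
    obtain ⟨j, hj, e⟩ := gstep_of_ne h
    rw [e]
    by_cases hij : i = j
    · subst hij
      rw [Function.update_self]
      rcases lt_trichotomy (q i - gpath p q t i) 0 with hlt | heq | hgt
      · rw [Int.sign_eq_neg_one_of_neg hlt]
        constructor
        · have : q i ≤ gpath p q t i - 1 := by omega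
          exact le_trans (min_le_right _ _) (by omega)
        · omega
      · exact absurd (sub_eq_zero.1 heq).symm hj
      · rw [Int.sign_eq_one_of_pos hgt]
        constructor
        · omega
        · have : gpath p q t i + 1 ≤ q i := by omega
          exact le_trans (by omega) (le_max_right _ _)
    · rw [Function.update_of_ne hij]; exact ih

/-- A coordinate in which `p` and `q` agree never moves. [folklore] -/
theorem gpath_apply_of_eq {p q : Site D} {i : Fin D} (h : p i = q i) (t : ℕ) : gpath p q t i = p i := by
  have := gpath_apply_mem p q i t
  rw [← h, min_self, max_self] at this
  omega

end Greedy

/-! ### Gadgets: explicit planar pieces carrying the patterns `V` and `V` reversed -/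

section Gadgets

/-- Two lattice triples differ by a unit vector. [folklore] -/
def TripleAdj (p q : ℤ × ℤ × ℤ) : Bool :=
  (decide (q.1 = p.1 + 1) && decide (q.2.1 = p.2.1) && decide (q.2.2 = p.2.2)) ||
  (decide (p.1 = q.1 + 1) && decide (q.2.1 = p.2.1) && decide (q.2.2 = p.2.2)) ||
  (decide (q.1 = p.1) && decide (q.2.1 = p.2.1 + 1) && decide (q.2.2 = p.2.2)) ||
  (decide (q.1 = p.1) && decide (p.2.1 = q.2.1 + 1) && decide (q.2.2 = p.2.2)) ||
  (decide (q.1 = p.1) && decide (q.2.1 = p.2.1) && decide (q.2.2 = p.2.2 + 1)) ||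
  (decide (q.1 = p.1) && decide (q.2.1 = p.2.1) && decide (p.2.2 = q.2.2 + 1))

/-- Consecutive entries of a list of triples are lattice neighbours. [folklore] -/
def ChainAdj : List (ℤ × ℤ × ℤ) → Bool
  | [] => true
  | [_] => true
  | p :: q :: l => TripleAdj p q && ChainAdj (q :: l)

/-- Gadget `P` (axis `eᵢ` with `i ≥ 2`, written as the third component `h`; planar components
`(a, b)` along `(e₀, e₁)`): from the axis point `h = -3` up to `h = 9`, with a bump spelling `V`
at `w = (1,0,-2)` and a bump spelling `V` backwards at `w' = (-4,0,5)`. [folklore] -/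
def gadgetP : List (ℤ × ℤ × ℤ) :=
  [(0,0,-3), (0,0,-2),
   (1,0,-2), (1,1,-2), (1,2,-2), (1,3,-2), (2,3,-2), (2,2,-2), (3,2,-2), (3,3,-2), (4,3,-2), (4,2,-2),
   (4,1,-2), (4,0,-2),
   (4,-1,-2), (4,-1,-1), (4,-1,0), (4,-1,1), (4,-1,2), (3,-1,2), (2,-1,2), (1,-1,2), (0,-1,2),
   (0,0,2), (0,0,3), (0,0,4), (0,0,5),
   (-1,0,5), (-1,1,5), (-1,2,5), (-1,3,5), (-2,3,5), (-2,2,5), (-3,2,5), (-3,3,5), (-4,3,5),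
   (-4,2,5), (-4,1,5), (-4,0,5),
   (-4,-1,5), (-4,-1,6), (-4,-1,7), (-4,-1,8), (-4,-1,9), (-3,-1,9), (-2,-1,9), (-1,-1,9),
   (0,-1,9), (0,0,9)]

/-- Gadget `Z` (axis `e₀`, the first component; planar, third component `0`): from the axis
point `a = -7` to `a = 7`, with `V` at `w = (-6,0)` (ending back on the axis) and `V` backwards
at `w' = (2,-6)`. [folklore] -/
def gadgetZ : List (ℤ × ℤ × ℤ) :=
  [(-7,0,0),
   (-6,0,0), (-6,1,0), (-6,2,0), (-6,3,0), (-5,3,0), (-5,2,0), (-4,2,0), (-4,3,0), (-3,3,0),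
   (-3,2,0), (-3,1,0), (-3,0,0),
   (-2,0,0), (-1,0,0), (0,0,0), (1,0,0),
   (1,-1,0), (1,-2,0), (2,-2,0), (3,-2,0), (4,-2,0), (5,-2,0), (6,-2,0), (6,-3,0), (6,-4,0),
   (6,-5,0), (6,-6,0),
   (5,-6,0), (5,-5,0), (5,-4,0), (5,-3,0), (4,-3,0), (4,-4,0), (3,-4,0), (3,-3,0), (2,-3,0),
   (2,-4,0), (2,-5,0), (2,-6,0),
   (2,-7,0), (3,-7,0), (4,-7,0), (5,-7,0), (6,-7,0), (7,-7,0), (7,-6,0), (7,-5,0), (7,-4,0),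
   (7,-3,0), (7,-2,0), (7,-1,0), (7,0,0)]

/-- Gadget `N` (axis `e₁`, the second component; planar): from the axis point `b = -9` to
`b = 9`, with `V` at `w = (0,-8)` and `V` backwards at `w' = (-5,4)`. [folklore] -/
def gadgetN : List (ℤ × ℤ × ℤ) :=
  [(0,-9,0),
   (0,-8,0), (0,-7,0), (0,-6,0), (0,-5,0), (1,-5,0), (1,-6,0), (2,-6,0), (2,-5,0), (3,-5,0),
   (3,-6,0), (3,-7,0), (3,-8,0),
   (4,-8,0), (4,-7,0), (4,-6,0), (4,-5,0), (4,-4,0), (3,-4,0), (2,-4,0), (1,-4,0), (0,-4,0),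
   (0,-3,0), (0,-2,0), (0,-1,0), (0,0,0), (0,1,0),
   (-1,1,0), (-2,1,0), (-2,2,0), (-2,3,0),
   (-2,4,0), (-2,5,0), (-2,6,0), (-2,7,0), (-3,7,0), (-3,6,0), (-4,6,0), (-4,7,0), (-5,7,0),
   (-5,6,0), (-5,5,0), (-5,4,0),
   (-5,3,0), (-6,3,0), (-6,4,0), (-6,5,0), (-6,6,0), (-6,7,0), (-6,8,0), (-6,9,0), (-5,9,0),
   (-4,9,0), (-3,9,0), (-2,9,0), (-1,9,0), (0,9,0)]

/-- Sanity checks of the three gadgets: lengths, nearest-neighbour chains, no repeated point.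
[folklore] -/
theorem gadget_checks :
    gadgetP.length = 49 ∧ gadgetZ.length = 53 ∧ gadgetN.length = 57 ∧
    ChainAdj gadgetP = true ∧ ChainAdj gadgetZ = true ∧ ChainAdj gadgetN = true ∧
    gadgetP.Nodup ∧ gadgetZ.Nodup ∧ gadgetN.Nodup := by
  refine ⟨rfl, rfl, rfl, by decide, by decide, by decide, by decide, by decide, by decide⟩

end Gadgets

/-! ### Walks traced by explicit lists of triples -/

section ListWalks

variable {d : ℕ}

/-- Embedding of a triple `(a, b, h)`: `a e₀ + b e₁ + h eᵢ` (for the planar gadgets `h = 0`).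
[folklore] -/
def emb (i : Fin (d + 2)) (p : ℤ × ℤ × ℤ) : Site (d + 2) := mk2 p.1 p.2.1 + Pi.single i p.2.2

/-- A list is *valid for the axis `i`*: either `i ≥ 2`, or all third components vanish.
[folklore] -/
def ValidFor (i : Fin (d + 2)) (l : List (ℤ × ℤ × ℤ)) : Prop :=
  2 ≤ i.val ∨ ∀ p ∈ l, p.2.2 = 0

/-- `emb i` is injective on triples valid for `i`. [folklore] -/
theorem emb_inj {i : Fin (d + 2)} {p q : ℤ × ℤ × ℤ} (hv : 2 ≤ i.val ∨ (p.2.2 = 0 ∧ q.2.2 = 0))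
    (h : emb i p = emb i q) : p = q := by
  obtain ⟨a, b, c⟩ := p
  obtain ⟨a', b', c'⟩ := q
  simp only [emb] at h
  rcases hv with hi | ⟨hc, hc'⟩
  · have hi0 : i ≠ 0 := by intro e; rw [e] at hi; simp at hi
    have hi1 : i ≠ 1 := by intro e; rw [e] at hi; simp at hi
    have h0 := congrFun h 0
    have h1 := congrFun h 1
    have h2 := congrFun h i
    simp only [Pi.add_apply, mk2_apply_zero, mk2_apply_one, Pi.single_eq_of_ne (Ne.symm hi0),
      Pi.single_eq_of_ne (Ne.symm hi1), Pi.single_eq_same, mk2_apply_of_ne _ _ hi0 hi1] at h0 h1 h2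
    simp only [Prod.mk.injEq]
    exact ⟨by linarith, by linarith, by linarith⟩
  · simp only at hc hc'
    subst hc; subst hc'
    simp only [Pi.single_zero, add_zero] at h
    have := mk2_inj h
    simp [this.1, this.2]

/-- Moving the first component of a triple. [folklore] -/
theorem emb_succ_a (i : Fin (d + 2)) (a b e : ℤ) : emb i (a + 1, b, e) = emb i (a, b, e) + mk2 1 0 := by
  simp only [emb]
  rw [show (mk2 (a + 1) b : Site (d + 2)) = mk2 a b + mk2 1 0 by rw [mk2_add]; simp]
  abel

/-- Moving the second component of a triple. [folklore] -/
theorem emb_succ_b (i : Fin (d + 2)) (a b e : ℤ) : emb i (a, b + 1, e) = emb i (a, b, e) + mk2 0 1 := by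
  simp only [emb]
  rw [show (mk2 a (b + 1) : Site (d + 2)) = mk2 a b + mk2 0 1 by rw [mk2_add]; simp]
  abel

/-- Moving the third component of a triple. [folklore] -/
theorem emb_succ_h (i : Fin (d + 2)) (a b e : ℤ) :
    emb i (a, b, e + 1) = emb i (a, b, e) + Pi.single i 1 := by
  simp only [emb, Pi.single_add]
  abel

/-- A step `+e₀`. [folklore] -/
theorem adj_add_mk2_10 (x : Site (d + 2)) : (zdGraph (d + 2)).Adj x (x + mk2 1 0) := by
  simpa using adj_add_mk2 x (a := 0) (b := 0) (a' := 1) (b' := 0) (Or.inl ⟨by ring, rfl⟩)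

/-- A step `+e₁`. [folklore] -/
theorem adj_add_mk2_01 (x : Site (d + 2)) : (zdGraph (d + 2)).Adj x (x + mk2 0 1) := by
  simpa using adj_add_mk2 x (a := 0) (b := 0) (a' := 0) (b' := 1) (Or.inr (Or.inr (Or.inl ⟨rfl, by ring⟩)))

/-- A step `+eᵢ`. [folklore] -/
theorem adj_add_single (x : Site (d + 2)) (i : Fin (d + 2)) : (zdGraph (d + 2)).Adj x (x + Pi.single i 1) := by
  rw [zdGraph_adj_iff]; exact ⟨i, Or.inl rfl⟩

/-- Lattice-adjacent valid triples embed to adjacent sites. [folklore] -/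
theorem adj_emb {i : Fin (d + 2)} {p q : ℤ × ℤ × ℤ} (hv : 2 ≤ i.val ∨ (p.2.2 = 0 ∧ q.2.2 = 0))
    (h : TripleAdj p q = true) (c : Site (d + 2)) :
    (zdGraph (d + 2)).Adj (c + emb i p) (c + emb i q) := by
  obtain ⟨a, b, e⟩ := p
  obtain ⟨a', b', e'⟩ := q
  simp only [TripleAdj, Bool.or_eq_true, Bool.and_eq_true, decide_eq_true_eq] at h
  simp only at hv
  rcases h with ((((⟨⟨h1, h2⟩, h3⟩ | ⟨⟨h1, h2⟩, h3⟩) | ⟨⟨h1, h2⟩, h3⟩) | ⟨⟨h1, h2⟩, h3⟩) |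
    ⟨⟨h1, h2⟩, h3⟩) | ⟨⟨h1, h2⟩, h3⟩
  · rw [h1, h2, h3, emb_succ_a, ← add_assoc]; exact adj_add_mk2_10 _
  · rw [h1, h2, h3, emb_succ_a, ← add_assoc]; exact (adj_add_mk2_10 _).symm
  · rw [h1, h2, h3, emb_succ_b, ← add_assoc]; exact adj_add_mk2_01 _
  · rw [h1, h2, h3, emb_succ_b, ← add_assoc]; exact (adj_add_mk2_01 _).symm
  · rcases hv with hi | ⟨he, he'⟩
    · rw [h1, h2, h3, emb_succ_h, ← add_assoc]; exact adj_add_single _ _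
    · omega
  · rcases hv with hi | ⟨he, he'⟩
    · rw [h1, h2, h3, emb_succ_h, ← add_assoc]; exact (adj_add_single _ _).symm
    · omega

/-- Consecutive entries of a `ChainAdj` list are adjacent triples. [folklore] -/
theorem chainAdj_get {l : List (ℤ × ℤ × ℤ)} (h : ChainAdj l = true) :
    ∀ t (ht : t + 1 < l.length), TripleAdj l[t] l[t + 1] = true := by
  induction l with
  | nil => intro t ht; simp at ht
  | cons p l ih =>
    intro t ht
    cases l with
    | nil => simp at ht
    | cons q l =>
      simp only [ChainAdj, Bool.and_eq_true] at h
      cases t with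
      | zero => simpa using h.1
      | succ t =>
        have := ih h.2 t (by simpa using ht)
        simpa using this

/-- The walk traced by a list of triples (frozen at its last entry), based at `c`. [folklore] -/
def listWalk (i : Fin (d + 2)) (c : Site (d + 2)) (l : List (ℤ × ℤ × ℤ)) : ℕ → Site (d + 2) :=
  fun t => c + emb i (l.getD (min t (l.length - 1)) (0, 0, 0))

/-- Values of the list walk inside the list. [folklore] -/
theorem listWalk_apply {i : Fin (d + 2)} {c : Site (d + 2)} {l : List (ℤ × ℤ × ℤ)} {t : ℕ}
    (ht : t < l.length) : listWalk i c l t = c + emb i l[t] := by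
  simp only [listWalk, min_eq_left (show t ≤ l.length - 1 by omega)]
  rw [List.getD_eq_getElem _ _ ht]

/-- The list walk is frozen from the last entry on. [folklore] -/
theorem listWalk_of_ge {i : Fin (d + 2)} {c : Site (d + 2)} {l : List (ℤ × ℤ × ℤ)} {t : ℕ}
    (ht : l.length - 1 ≤ t) : listWalk i c l t = listWalk i c l (l.length - 1) := by
  simp only [listWalk, min_eq_right ht, min_self]

/-- **A `ChainAdj`, repetition-free, valid list traces a self-avoiding path.** [folklore] -/
theorem pathOn_listWalk {i : Fin (d + 2)} {l : List (ℤ × ℤ × ℤ)} (hc : ChainAdj l = true)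
    (hn : l.Nodup) (hv : ValidFor i l) (c : Site (d + 2)) :
    PathOn (l.length - 1) (listWalk i c l) := by
  have hv' : ∀ p ∈ l, ∀ q ∈ l, 2 ≤ i.val ∨ (p.2.2 = 0 ∧ q.2.2 = 0) := by
    intro p hp q hq
    rcases hv with h | h
    · exact Or.inl h
    · exact Or.inr ⟨h p hp, h q hq⟩
  refine ⟨fun t ht => ?_, fun s hs t ht hst => ?_⟩
  · rw [listWalk_apply (by omega), listWalk_apply (by omega)]
    exact adj_emb (hv' _ (List.getElem_mem _) _ (List.getElem_mem _)) (chainAdj_get hc t (by omega)) c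
  · simp only [Set.mem_setOf_eq] at hs ht
    rcases Nat.eq_zero_or_pos l.length with h0 | hpos
    · omega
    rw [listWalk_apply (by omega), listWalk_apply (by omega)] at hst
    have h1 := emb_inj (hv' _ (List.getElem_mem _) _ (List.getElem_mem _)) (add_left_cancel hst)
    exact (List.Nodup.getElem_inj_iff hn).1 h1

end ListWalks

/-! ### The three gadgets as walks: interface `(G1)`–`(G6)` -/

section GadgetWalks

variable {d : ℕ}

/-- Decidable test: the triple `p` lies in the cube `w + [0,3]³`. [folklore] -/
def TripleInCube (w p : ℤ × ℤ × ℤ) : Bool :=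
  decide (0 ≤ p.1 - w.1) && decide (p.1 - w.1 ≤ 3) && decide (0 ≤ p.2.1 - w.2.1) &&
    decide (p.2.1 - w.2.1 ≤ 3) && decide (0 ≤ p.2.2 - w.2.2) && decide (p.2.2 - w.2.2 ≤ 3)

/-- Decidable test: the entries `l[k], …, l[k+11]` spell `w + V`, `w = l[k]`. [folklore] -/
def HasVAt (l : List (ℤ × ℤ × ℤ)) (k : ℕ) : Bool :=
  (List.range 12).all fun s =>
    l[k + s]? == some ((l.getD k (0,0,0)).1 + (vCoord s).1, (l.getD k (0,0,0)).2.1 + (vCoord s).2,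
      (l.getD k (0,0,0)).2.2)

/-- Decidable test: the entries `l[k], …, l[k+11]` spell `w' + V` backwards, `w' = l[k+11]`.
[folklore] -/
def HasVrevAt (l : List (ℤ × ℤ × ℤ)) (k : ℕ) : Bool :=
  (List.range 12).all fun s =>
    l[k + s]? == some ((l.getD (k + 11) (0,0,0)).1 + (vCoord (11 - s)).1,
      (l.getD (k + 11) (0,0,0)).2.1 + (vCoord (11 - s)).2, (l.getD (k + 11) (0,0,0)).2.2)

/-- Decidable test: all entries outside the window `[k, k+11]` avoid the cube `w + [0,3]³`.
[folklore] -/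
def CleanAt (l : List (ℤ × ℤ × ℤ)) (k : ℕ) (w : ℤ × ℤ × ℤ) : Bool :=
  (List.range l.length).all fun t => decide (k ≤ t ∧ t ≤ k + 11) || !TripleInCube w (l.getD t (0,0,0))

/-- Decidable test: all components of all entries are at most `9` in absolute value, and the
`ax`-component (the level along the axis) lies in `[lo, hi]`. [folklore] -/
def InRanges (l : List (ℤ × ℤ × ℤ)) (ax : ℕ) (lo hi : ℤ) : Bool :=
  l.all fun p => decide (|p.1| ≤ 9) && decide (|p.2.1| ≤ 9) && decide (|p.2.2| ≤ 9) &&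
    decide (lo ≤ (if ax = 0 then p.1 else if ax = 1 then p.2.1 else p.2.2)) &&
    decide ((if ax = 0 then p.1 else if ax = 1 then p.2.1 else p.2.2) ≤ hi)

/-- The level (axis component) of a triple, for the axis case `ax ∈ {0, 1, ≥ 2}`. [folklore] -/
def tlevel (ax : ℕ) (p : ℤ × ℤ × ℤ) : ℤ := if ax = 0 then p.1 else if ax = 1 then p.2.1 else p.2.2

/-- The verified properties of the three gadgets (by computation): the forward `V` at `k₀`, the
backward `V` at `k₁`, cleanliness of both cubes within the gadget, coordinate ranges, and the
levels of the two cube corners (at least `4` below the exit level). [folklore] -/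
theorem gadget_specs :
    (HasVAt gadgetP 2 = true ∧ CleanAt gadgetP 2 (gadgetP.getD 2 (0,0,0)) = true ∧
      HasVrevAt gadgetP 27 = true ∧ CleanAt gadgetP 27 (gadgetP.getD 38 (0,0,0)) = true ∧
      InRanges gadgetP 2 (-3) 9 = true ∧
      (tlevel 2 (gadgetP.getD 2 (0,0,0)) + 3 < 9 ∧ tlevel 2 (gadgetP.getD 38 (0,0,0)) + 3 < 9)) ∧
    (HasVAt gadgetZ 1 = true ∧ CleanAt gadgetZ 1 (gadgetZ.getD 1 (0,0,0)) = true ∧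
      HasVrevAt gadgetZ 28 = true ∧ CleanAt gadgetZ 28 (gadgetZ.getD 39 (0,0,0)) = true ∧
      InRanges gadgetZ 0 (-7) 7 = true ∧
      (tlevel 0 (gadgetZ.getD 1 (0,0,0)) + 3 < 7 ∧ tlevel 0 (gadgetZ.getD 39 (0,0,0)) + 3 < 7) ∧
      gadgetZ.all (fun p => decide (p.2.2 = 0)) = true) ∧
    (HasVAt gadgetN 1 = true ∧ CleanAt gadgetN 1 (gadgetN.getD 1 (0,0,0)) = true ∧
      HasVrevAt gadgetN 31 = true ∧ CleanAt gadgetN 31 (gadgetN.getD 42 (0,0,0)) = true ∧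
      InRanges gadgetN 1 (-9) 9 = true ∧
      (tlevel 1 (gadgetN.getD 1 (0,0,0)) + 3 < 9 ∧ tlevel 1 (gadgetN.getD 42 (0,0,0)) + 3 < 9) ∧
      gadgetN.all (fun p => decide (p.2.2 = 0)) = true) := by
  refine ⟨⟨by decide, by decide, by decide, by decide, by decide, by decide⟩,
    ⟨by decide, by decide, by decide, by decide, by decide, by decide, by decide⟩,
    ⟨by decide, by decide, by decide, by decide, by decide, by decide, by decide⟩⟩

/-- The gadget list for the axis `i`. [folklore] -/
def gadgetList (i : Fin (d + 2)) : List (ℤ × ℤ × ℤ) :=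
  if i.val = 0 then gadgetZ else if i.val = 1 then gadgetN else gadgetP

/-- The gadget walk for the axis `i` (based at the origin). [folklore] -/
def gadgetWalk (i : Fin (d + 2)) : ℕ → Site (d + 2) := listWalk i 0 (gadgetList i)

/-- The length of the gadget for the axis `i`. [folklore] -/
def gadgetLen (i : Fin (d + 2)) : ℕ := (gadgetList i).length - 1

/-- The entry level of the gadget on the axis `i`. [folklore] -/
def gadgetLo (i : Fin (d + 2)) : ℤ := if i.val = 0 then -7 else if i.val = 1 then -9 else -3

/-- The exit level of the gadget on the axis `i`. [folklore] -/
def gadgetHi (i : Fin (d + 2)) : ℤ := if i.val = 0 then 7 else 9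

/-- The step of the gadget at which `(V, Q)` occurs. [folklore] -/
def gadgetKV (i : Fin (d + 2)) : ℕ := if 2 ≤ i.val then 2 else 1

/-- The step of the gadget at which `V` starts backwards. [folklore] -/
def gadgetKR (i : Fin (d + 2)) : ℕ := if i.val = 0 then 28 else if i.val = 1 then 31 else 27

/-- Case analysis on the axis. [folklore] -/
theorem fin_cases3 (i : Fin (d + 2)) : i.val = 0 ∨ i.val = 1 ∨ 2 ≤ i.val := by omega

/-- The gadget list is valid for its axis. [folklore] -/
theorem validFor_gadgetList (i : Fin (d + 2)) : ValidFor i (gadgetList i) := by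
  unfold ValidFor gadgetList
  rcases fin_cases3 i with h | h | h
  · right; rw [if_pos h]
    have := gadget_specs.2.1.2.2.2.2.2.2
    intro p hp; simpa using List.all_eq_true.1 this p hp
  · right; rw [if_neg (by omega), if_pos h]
    have := gadget_specs.2.2.2.2.2.2.2.2
    intro p hp; simpa using List.all_eq_true.1 this p hp
  · left; exact h

/-- **(G1)** The gadget walk is a self-avoiding path. [folklore] -/
theorem pathOn_gadgetWalk (i : Fin (d + 2)) : PathOn (gadgetLen i) (gadgetWalk i) := by
  unfold gadgetLen gadgetWalk
  refine pathOn_listWalk ?_ ?_ (validFor_gadgetList i) 0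
  · unfold gadgetList; split_ifs
    · exact gadget_checks.2.2.2.2.1
    · exact gadget_checks.2.2.2.2.2.1
    · exact gadget_checks.2.2.2.1
  · unfold gadgetList; split_ifs
    · exact gadget_checks.2.2.2.2.2.2.2.1
    · exact gadget_checks.2.2.2.2.2.2.2.2
    · exact gadget_checks.2.2.2.2.2.2.1

/-- The lengths of the gadgets (`52`, `56`, `48`). [folklore] -/
theorem gadgetLen_eq (i : Fin (d + 2)) :
    gadgetLen i = if i.val = 0 then 52 else if i.val = 1 then 56 else 48 := by
  unfold gadgetLen gadgetList
  split_ifs <;> rfl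

/-- The gadget is at least `12` steps long and at most `56`. [folklore] -/
theorem gadgetLen_bounds (i : Fin (d + 2)) : 12 ≤ gadgetLen i ∧ gadgetLen i ≤ 56 := by
  rw [gadgetLen_eq]; split_ifs <;> norm_num

/-- `emb` of a triple with only a level component is a multiple of the axis vector. [folklore] -/
theorem emb_level (i : Fin (d + 2)) (t : ℤ) :
    emb i (if i.val = 0 then (t, 0, 0) else if i.val = 1 then (0, t, 0) else (0, 0, t)) =
      Pi.single i t := by
  rcases fin_cases3 i with h | h | h
  · have hi : i = 0 := Fin.ext h
    subst hi
    simp [emb, mk2]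
  · have hi : i = 1 := Fin.ext h
    subst hi
    simp [emb, mk2]
  · rw [if_neg (by omega), if_neg (by omega)]
    simp [emb, mk2]

/-- **(G2)** The gadget enters on the axis at level `gadgetLo i`. [folklore] -/
theorem gadgetWalk_zero (i : Fin (d + 2)) : gadgetWalk i 0 = Pi.single i (gadgetLo i) := by
  unfold gadgetWalk gadgetLo
  rw [listWalk_apply (by unfold gadgetList; split_ifs <;> decide), zero_add, ← emb_level]
  congr 1
  unfold gadgetList
  rcases fin_cases3 i with h | h | h
  · simp [h, gadgetZ]
  · simp [h, gadgetN]
  · simp [show ¬ i.val = 0 by omega, show ¬ i.val = 1 by omega, gadgetP]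

/-- **(G2)** The gadget leaves on the axis at level `gadgetHi i`. [folklore] -/
theorem gadgetWalk_len (i : Fin (d + 2)) : gadgetWalk i (gadgetLen i) = Pi.single i (gadgetHi i) := by
  unfold gadgetWalk gadgetHi gadgetLen
  rw [listWalk_apply (by unfold gadgetList; split_ifs <;> decide), zero_add, ← emb_level]
  congr 1
  unfold gadgetList
  rcases fin_cases3 i with h | h | h
  · simp [h, gadgetZ]
  · simp [h, gadgetN]
  · simp [show ¬ i.val = 0 by omega, show ¬ i.val = 1 by omega, gadgetP]

/-- Coordinates of embedded triples (valid for the axis). [folklore] -/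
theorem emb_apply (i : Fin (d + 2)) (p : ℤ × ℤ × ℤ) (hv : 2 ≤ i.val ∨ p.2.2 = 0) (j : Fin (d + 2)) :
    emb i p j = (if j.val = 0 then p.1 else 0) + (if j.val = 1 then p.2.1 else 0) +
      (if j = i then p.2.2 else 0) := by
  unfold emb mk2
  simp only [Pi.add_apply]
  have e0 : (Pi.single (0 : Fin (d + 2)) p.1 : Site (d + 2)) j = if j.val = 0 then p.1 else 0 := by
    by_cases h : j = 0
    · subst h; simp
    · have h' : ¬ j.val = 0 := fun e => h (Fin.ext (by simp [e]))
      rw [Pi.single_eq_of_ne h, if_neg h']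
  have e1 : (Pi.single (1 : Fin (d + 2)) p.2.1 : Site (d + 2)) j = if j.val = 1 then p.2.1 else 0 := by
    by_cases h : j = 1
    · subst h; simp
    · have h' : ¬ j.val = 1 := fun e => h (Fin.ext (by simp [e]))
      rw [Pi.single_eq_of_ne h, if_neg h']
  have e2 : (Pi.single i p.2.2 : Site (d + 2)) j = if j = i then p.2.2 else 0 := by
    by_cases h : j = i
    · subst h; simp
    · rw [Pi.single_eq_of_ne h, if_neg h]
  rw [e0, e1, e2]

/-- The level (axis coordinate) of an embedded valid triple. [folklore] -/
theorem emb_apply_self (i : Fin (d + 2)) (p : ℤ × ℤ × ℤ) (hv : 2 ≤ i.val ∨ p.2.2 = 0) :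
    emb i p i = (if i.val = 0 then p.1 else if i.val = 1 then p.2.1 else p.2.2) := by
  rw [emb_apply i p hv i, if_pos rfl]
  rcases fin_cases3 i with h | h | h
  · rcases hv with h' | h'
    · omega
    · simp [h, h']
  · rcases hv with h' | h'
    · omega
    · simp [h, h']
  · simp [show ¬ i.val = 0 by omega, show ¬ i.val = 1 by omega]

/-- All coordinates of an embedded valid triple are bounded by its components. [folklore] -/
theorem abs_emb_apply_le (i : Fin (d + 2)) (p : ℤ × ℤ × ℤ) (hv : 2 ≤ i.val ∨ p.2.2 = 0)
    {M : ℤ} (h1 : |p.1| ≤ M) (h2 : |p.2.1| ≤ M) (h3 : |p.2.2| ≤ M) (j : Fin (d + 2)) :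
    |emb i p j| ≤ M := by
  have hM : 0 ≤ M := le_trans (abs_nonneg _) h1
  rw [emb_apply i p hv j]
  rcases fin_cases3 j with hj | hj | hj
  · have hj1 : ¬ j.val = 1 := by omega
    rw [if_pos hj, if_neg hj1, add_zero]
    by_cases hji : j = i
    · rw [if_pos hji]
      rcases hv with h' | h'
      · subst hji; omega
      · rw [h', add_zero]; exact h1
    · rw [if_neg hji, add_zero]; exact h1
  · have hj0 : ¬ j.val = 0 := by omega
    rw [if_neg hj0, if_pos hj, zero_add]
    by_cases hji : j = i
    · rw [if_pos hji]
      rcases hv with h' | h'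
      · subst hji; omega
      · rw [h', add_zero]; exact h2
    · rw [if_neg hji, add_zero]; exact h2
  · rw [if_neg (by omega), if_neg (by omega), zero_add, zero_add]
    split_ifs
    · exact h3
    · simp [hM]

/-- Transport of `InRanges` to the gadget walk: **(G3)** levels in `[lo, hi]` and **(G4)** all
coordinates at most `9`. [folklore] -/
theorem gadgetWalk_ranges (i : Fin (d + 2)) {t : ℕ} (ht : t ≤ gadgetLen i) :
    (gadgetLo i ≤ gadgetWalk i t i ∧ gadgetWalk i t i ≤ gadgetHi i) ∧
      ∀ j, |gadgetWalk i t j| ≤ 9 := by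
  have hlen : t < (gadgetList i).length := by unfold gadgetLen at ht; have := gadgetLen_bounds i; unfold gadgetLen at this; omega
  have hv : 2 ≤ i.val ∨ ((gadgetList i)[t]).2.2 = 0 := by
    rcases validFor_gadgetList i with h | h
    · exact Or.inl h
    · exact Or.inr (h _ (List.getElem_mem _))
  have hR : InRanges (gadgetList i) i.val (gadgetLo i) (gadgetHi i) = true := by
    unfold gadgetList gadgetLo gadgetHi
    rcases fin_cases3 i with h | h | h
    · simp only [h, if_true]; exact gadget_specs.2.1.2.2.2.2.1
    · simp only [h, show (1 : ℕ) ≠ 0 from one_ne_zero, if_false, if_true]; exact gadget_specs.2.2.2.2.2.2.1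
    · simp only [show ¬ i.val = 0 by omega, show ¬ i.val = 1 by omega, if_false]
      have := gadget_specs.1.2.2.2.2.1
      simp only [InRanges, show ¬ (2 : ℕ) = 0 by norm_num, show ¬ (2 : ℕ) = 1 by norm_num, if_false] at this
      simp only [InRanges, show ¬ i.val = 0 by omega, show ¬ i.val = 1 by omega, if_false]
      exact this
  have hp := List.all_eq_true.1 hR _ (List.getElem_mem hlen)
  simp only [Bool.and_eq_true, decide_eq_true_eq] at hp
  obtain ⟨⟨⟨⟨h1, h2⟩, h3⟩, h4⟩, h5⟩ := hp
  unfold gadgetWalk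
  rw [listWalk_apply hlen, zero_add]
  refine ⟨?_, fun j => abs_emb_apply_le i _ hv h1 h2 h3 j⟩
  rw [emb_apply_self i _ hv]
  exact ⟨h4, h5⟩

end GadgetWalks

/-! ### The `V`-occurrences carried by the gadgets: interface `(G5)`, `(G6)` -/

section GadgetOcc

variable {d : ℕ}

/-- Translating a triple in the plane translates its embedding. [folklore] -/
theorem emb_add_planar (i : Fin (d + 2)) (a b e a' b' : ℤ) :
    emb i (a + a', b + b', e) = emb i (a, b, e) + mk2 a' b' := by
  simp only [emb]
  rw [← mk2_add]
  abel

/-- Coordinates of embedded valid triples: the three named ones and the rest. [folklore] -/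
theorem emb_coords (i : Fin (d + 2)) (q : ℤ × ℤ × ℤ) (hv : 2 ≤ i.val ∨ q.2.2 = 0) :
    emb i q 0 = q.1 ∧ emb i q 1 = q.2.1 ∧ (2 ≤ i.val → emb i q i = q.2.2) ∧
      ∀ j : Fin (d + 2), j.val ≠ 0 → j.val ≠ 1 → j ≠ i → emb i q j = 0 := by
  refine ⟨?_, ?_, fun hi => ?_, fun j hj0 hj1 hji => ?_⟩
  · simp only [emb, Pi.add_apply, mk2_apply_zero]
    by_cases h0 : (0 : Fin (d + 2)) = i
    · rcases hv with hi | hq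
      · exfalso; rw [← h0] at hi; simp at hi
      · rw [← h0, Pi.single_eq_same, hq, add_zero]
    · rw [Pi.single_eq_of_ne h0, add_zero]
  · simp only [emb, Pi.add_apply, mk2_apply_one]
    by_cases h1 : (1 : Fin (d + 2)) = i
    · rcases hv with hi | hq
      · exfalso; rw [← h1] at hi; simp at hi
      · rw [← h1, Pi.single_eq_same, hq, add_zero]
    · rw [Pi.single_eq_of_ne h1, add_zero]
  · have hi0 : i ≠ 0 := by intro e; rw [e] at hi; simp at hi
    have hi1 : i ≠ 1 := by intro e; rw [e] at hi; simp at hi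
    simp only [emb, Pi.add_apply, mk2_apply_of_ne _ _ hi0 hi1, Pi.single_eq_same, zero_add]
  · have hj0' : j ≠ 0 := fun e => hj0 (by rw [e]; simp)
    have hj1' : j ≠ 1 := fun e => hj1 (by rw [e]; simp)
    simp only [emb, Pi.add_apply, mk2_apply_of_ne _ _ hj0' hj1', Pi.single_eq_of_ne hji, add_zero]

/-- `TripleInCube` is membership in the cube for embedded valid triples. [folklore] -/
theorem inCube_emb_iff {i : Fin (d + 2)} {w p : ℤ × ℤ × ℤ}
    (hv : 2 ≤ i.val ∨ (w.2.2 = 0 ∧ p.2.2 = 0)) (c : Site (d + 2)) :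
    InCube (c + emb i w) (c + emb i p) ↔ TripleInCube w p = true := by
  have hvw : 2 ≤ i.val ∨ w.2.2 = 0 := hv.imp id And.left
  have hvp : 2 ≤ i.val ∨ p.2.2 = 0 := hv.imp id And.right
  obtain ⟨pw0, pw1, pwi, pwo⟩ := emb_coords i w hvw
  obtain ⟨pp0, pp1, ppi, ppo⟩ := emb_coords i p hvp
  simp only [InCube, TripleInCube, Bool.and_eq_true, decide_eq_true_eq, Pi.add_apply,
    add_sub_add_left_eq_sub]
  constructor
  · intro h
    have h0 := h 0
    have h1 := h 1
    rw [pp0, pw0] at h0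
    rw [pp1, pw1] at h1
    rcases hv with hi | ⟨hw, hp⟩
    · have h2 := h i
      rw [ppi hi, pwi hi] at h2
      exact ⟨⟨⟨⟨⟨h0.1, h0.2⟩, h1.1⟩, h1.2⟩, h2.1⟩, h2.2⟩
    · rw [hw, hp, sub_self]
      exact ⟨⟨⟨⟨⟨h0.1, h0.2⟩, h1.1⟩, h1.2⟩, le_rfl⟩, by norm_num⟩
  · rintro ⟨⟨⟨⟨⟨h1, h2⟩, h3⟩, h4⟩, h5⟩, h6⟩ j
    by_cases hj0 : j = 0
    · subst hj0; rw [pp0, pw0]; exact ⟨h1, h2⟩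
    by_cases hj1 : j = 1
    · subst hj1; rw [pp1, pw1]; exact ⟨h3, h4⟩
    by_cases hji : j = i
    · subst hji
      have hj2 : 2 ≤ j.val := by
        rcases fin_cases3 j with e | e | e
        · exact absurd (Fin.ext (by simp [e])) hj0
        · exact absurd (Fin.ext (by simp [e])) hj1
        · exact e
      rw [ppi hj2, pwi hj2]; exact ⟨h5, h6⟩
    · have hj0' : j.val ≠ 0 := fun e => hj0 (Fin.ext (by simp [e]))
      have hj1' : j.val ≠ 1 := fun e => hj1 (Fin.ext (by simp [e]))
      rw [ppo j hj0' hj1' hji, pwo j hj0' hj1' hji, sub_self]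
      norm_num

/-- From `HasVAt`: the entries of the window. [folklore] -/
theorem hasVAt_getElem {l : List (ℤ × ℤ × ℤ)} {k : ℕ} (h : HasVAt l k = true)
    (hk : k + 11 < l.length) {s : ℕ} (hs : s ≤ 11) :
    l[k + s]'(by omega) = ((l[k]'(by omega)).1 + (vCoord s).1, (l[k]'(by omega)).2.1 + (vCoord s).2,
      (l[k]'(by omega)).2.2) := by
  have h1 := List.all_eq_true.1 h s (List.mem_range.2 (by omega))
  rw [beq_iff_eq, List.getD_eq_getElem _ _ (show k < l.length by omega),
    List.getElem?_eq_getElem (by omega)] at h1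
  exact Option.some_injective _ h1

/-- From `HasVrevAt`: the entries of the window. [folklore] -/
theorem hasVrevAt_getElem {l : List (ℤ × ℤ × ℤ)} {k : ℕ} (h : HasVrevAt l k = true)
    (hk : k + 11 < l.length) {s : ℕ} (hs : s ≤ 11) :
    l[k + s]'(by omega) = ((l[k + 11]'hk).1 + (vCoord (11 - s)).1,
      (l[k + 11]'hk).2.1 + (vCoord (11 - s)).2, (l[k + 11]'hk).2.2) := by
  have h1 := List.all_eq_true.1 h s (List.mem_range.2 (by omega))
  rw [beq_iff_eq, List.getD_eq_getElem _ _ hk, List.getElem?_eq_getElem (by omega)] at h1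
  exact Option.some_injective _ h1

/-- **Forward segment**: with `HasVAt`, the list walk spells `V` from step `k`. [folklore] -/
theorem listWalk_seg_of_hasVAt {i : Fin (d + 2)} {c : Site (d + 2)} {l : List (ℤ × ℤ × ℤ)}
    {k : ℕ} (h : HasVAt l k = true) (hk : k + 11 < l.length) {s : ℕ} (hs : s ≤ 11) :
    listWalk i c l (k + s) = listWalk i c l k + vPt s := by
  rw [listWalk_apply (by omega), listWalk_apply (by omega), hasVAt_getElem h hk hs]
  obtain ⟨a, b, e⟩ := l[k]'(by omega)
  rw [emb_add_planar, add_assoc]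
  rfl

/-- **Backward segment**: with `HasVrevAt`, the list walk spells `V` backwards on
`[k, k + 11]`. [folklore] -/
theorem listWalk_seg_of_hasVrevAt {i : Fin (d + 2)} {c : Site (d + 2)} {l : List (ℤ × ℤ × ℤ)}
    {k : ℕ} (h : HasVrevAt l k = true) (hk : k + 11 < l.length) {s : ℕ} (hs : s ≤ 11) :
    listWalk i c l (k + s) = listWalk i c l (k + 11) + vPt (11 - s) := by
  rw [listWalk_apply (by omega), listWalk_apply (by omega), hasVrevAt_getElem h hk hs]
  obtain ⟨a, b, e⟩ := l[k + 11]'hk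
  rw [emb_add_planar, add_assoc]
  rfl

/-- **Cleanliness**: with `CleanAt`, the entries outside the window avoid the cube. [folklore] -/
theorem listWalk_avoid_of_cleanAt {i : Fin (d + 2)} {c : Site (d + 2)} {l : List (ℤ × ℤ × ℤ)}
    {k m : ℕ} (hm : m < l.length) (h : CleanAt l k (l[m]) = true) (hv : ValidFor i l) {t : ℕ}
    (ht : t < l.length) (hout : t < k ∨ k + 11 < t) :
    ¬ InCube (listWalk i c l m) (listWalk i c l t) := by
  have h1 := List.all_eq_true.1 h t (List.mem_range.2 ht)
  rw [Bool.or_eq_true, decide_eq_true_eq, List.getD_eq_getElem _ _ ht] at h1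
  rcases h1 with h1 | h1
  · omega
  · rw [listWalk_apply hm, listWalk_apply ht, inCube_emb_iff]
    · simpa using h1
    · rcases hv with hi | hz
      · exact Or.inl hi
      · exact Or.inr ⟨hz _ (List.getElem_mem _), hz _ (List.getElem_mem _)⟩

/-- Dispatch of the computed specs to the axis `i`: forward `V`. [folklore] -/
theorem gadget_spec_V (i : Fin (d + 2)) :
    HasVAt (gadgetList i) (gadgetKV i) = true ∧
      CleanAt (gadgetList i) (gadgetKV i) ((gadgetList i).getD (gadgetKV i) (0,0,0)) = true ∧
      tlevel i.val ((gadgetList i).getD (gadgetKV i) (0,0,0)) + 3 < gadgetHi i := by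
  unfold gadgetList gadgetKV gadgetHi
  rcases fin_cases3 i with h | h | h
  · simp only [h, if_true, show ¬ (2 ≤ 0) by norm_num, if_false]
    exact ⟨gadget_specs.2.1.1, gadget_specs.2.1.2.1, gadget_specs.2.1.2.2.2.2.2.1.1⟩
  · simp only [h, show (1 : ℕ) ≠ 0 from one_ne_zero, show ¬ (2 ≤ 1) by norm_num, if_false, if_true]
    exact ⟨gadget_specs.2.2.1, gadget_specs.2.2.2.1, gadget_specs.2.2.2.2.2.2.2.1.1⟩
  · simp only [show ¬ i.val = 0 by omega, show ¬ i.val = 1 by omega, h, if_false, if_true]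
    refine ⟨gadget_specs.1.1, gadget_specs.1.2.1, ?_⟩
    have := gadget_specs.1.2.2.2.2.2.1
    simp only [tlevel, show ¬ (2 : ℕ) = 0 by norm_num, show ¬ (2 : ℕ) = 1 by norm_num, if_false] at this
    simp only [tlevel, show ¬ i.val = 0 by omega, show ¬ i.val = 1 by omega, if_false]
    exact this

/-- Dispatch of the computed specs to the axis `i`: backward `V`. [folklore] -/
theorem gadget_spec_R (i : Fin (d + 2)) :
    HasVrevAt (gadgetList i) (gadgetKR i) = true ∧
      CleanAt (gadgetList i) (gadgetKR i) ((gadgetList i).getD (gadgetKR i + 11) (0,0,0)) = true ∧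
      tlevel i.val ((gadgetList i).getD (gadgetKR i + 11) (0,0,0)) + 3 < gadgetHi i := by
  unfold gadgetList gadgetKR gadgetHi
  rcases fin_cases3 i with h | h | h
  · simp only [h, if_true]
    exact ⟨gadget_specs.2.1.2.2.1, gadget_specs.2.1.2.2.2.1, gadget_specs.2.1.2.2.2.2.2.1.2⟩
  · simp only [h, show (1 : ℕ) ≠ 0 from one_ne_zero, if_false, if_true]
    exact ⟨gadget_specs.2.2.2.2.1, gadget_specs.2.2.2.2.2.1, gadget_specs.2.2.2.2.2.2.2.1.2⟩
  · simp only [show ¬ i.val = 0 by omega, show ¬ i.val = 1 by omega, if_false]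
    refine ⟨gadget_specs.1.2.2.1, gadget_specs.1.2.2.2.1, ?_⟩
    have := gadget_specs.1.2.2.2.2.2.2
    simp only [tlevel, show ¬ (2 : ℕ) = 0 by norm_num, show ¬ (2 : ℕ) = 1 by norm_num, if_false] at this
    simp only [tlevel, show ¬ i.val = 0 by omega, show ¬ i.val = 1 by omega, if_false]
    exact this

/-- Index bounds of the two windows inside the gadget. [folklore] -/
theorem gadgetK_bounds (i : Fin (d + 2)) :
    gadgetKV i + 11 < (gadgetList i).length ∧ gadgetKR i + 11 < (gadgetList i).length ∧
      gadgetKV i + 11 ≤ gadgetLen i ∧ gadgetKR i + 11 ≤ gadgetLen i ∧ 1 ≤ gadgetKV i := by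
  unfold gadgetKV gadgetKR gadgetLen gadgetList
  rcases fin_cases3 i with h | h | h
  · simp only [h]; decide
  · simp only [h]; decide
  · simp only [show ¬ i.val = 0 by omega, show ¬ i.val = 1 by omega, h, if_false, if_true]; decide

/-- The level of a gadget entry is the axis coordinate of the corresponding point. [folklore] -/
theorem gadgetWalk_apply_self (i : Fin (d + 2)) {t : ℕ} (ht : t < (gadgetList i).length) :
    gadgetWalk i t i = tlevel i.val ((gadgetList i)[t]) := by
  unfold gadgetWalk
  rw [listWalk_apply ht, zero_add, emb_apply_self]
  · rfl
  · rcases validFor_gadgetList i with h | h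
    · exact Or.inl h
    · exact Or.inr (h _ (List.getElem_mem _))

/-- **(G5)** The forward `V` of the gadget: `(V, Q)` occurs at step `gadgetKV i` within the
gadget, and the cube corner lies at least `4` levels below the exit. [folklore] -/
theorem gadget_occV (i : Fin (d + 2)) :
    gadgetKV i + 11 ≤ gadgetLen i ∧
    (∀ s ≤ 11, gadgetWalk i (gadgetKV i + s) = gadgetWalk i (gadgetKV i) + vPt s) ∧
    (∀ t ≤ gadgetLen i, (t < gadgetKV i ∨ gadgetKV i + 11 < t) →
      ¬ InCube (gadgetWalk i (gadgetKV i)) (gadgetWalk i t)) ∧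
    gadgetWalk i (gadgetKV i) i + 3 < gadgetHi i := by
  obtain ⟨hV, hC, hL⟩ := gadget_spec_V i
  obtain ⟨hk, -, hk', -, -⟩ := gadgetK_bounds i
  refine ⟨hk', fun s hs => listWalk_seg_of_hasVAt hV hk hs, fun t ht hout => ?_, ?_⟩
  · rw [List.getD_eq_getElem _ _ (show gadgetKV i < (gadgetList i).length by omega)] at hC
    exact listWalk_avoid_of_cleanAt _ hC (validFor_gadgetList i)
      (by unfold gadgetLen at ht; omega) hout
  · rw [gadgetWalk_apply_self i (by omega)]
    rwa [List.getD_eq_getElem _ _ (show gadgetKV i < (gadgetList i).length by omega)] at hL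

/-- **(G6)** The backward `V` of the gadget: on `[gadgetKR i, gadgetKR i + 11]` the gadget spells
`V` backwards from the corner `gadgetWalk i (gadgetKR i + 11)`, cleanly, and this corner lies
at least `4` levels below the exit. [folklore] -/
theorem gadget_occVrev (i : Fin (d + 2)) :
    gadgetKR i + 11 ≤ gadgetLen i ∧
    (∀ s ≤ 11, gadgetWalk i (gadgetKR i + s) = gadgetWalk i (gadgetKR i + 11) + vPt (11 - s)) ∧
    (∀ t ≤ gadgetLen i, (t < gadgetKR i ∨ gadgetKR i + 11 < t) →
      ¬ InCube (gadgetWalk i (gadgetKR i + 11)) (gadgetWalk i t)) ∧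
    gadgetWalk i (gadgetKR i + 11) i + 3 < gadgetHi i := by
  obtain ⟨hV, hC, hL⟩ := gadget_spec_R i
  obtain ⟨-, hk, -, hk', -⟩ := gadgetK_bounds i
  refine ⟨hk', fun s hs => listWalk_seg_of_hasVrevAt hV hk hs, fun t ht hout => ?_, ?_⟩
  · rw [List.getD_eq_getElem _ _ hk] at hC
    exact listWalk_avoid_of_cleanAt _ hC (validFor_gadgetList i)
      (by unfold gadgetLen at ht; omega) hout
  · rw [gadgetWalk_apply_self i hk]
    rwa [List.getD_eq_getElem _ _ hk] at hL

end GadgetOcc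

/-! ### The route from `x` to `y` inside the cube of radius `13`: assembly -/

section Route

variable {d : ℕ}

/-- If `z` and `q` agree off the coordinate `i`, their `ℓ¹` distance is `|q i - z i|`. [folklore] -/
theorem dist1_of_agree {i : Fin (d + 2)} {z q : Site (d + 2)} (h : ∀ j, j ≠ i → z j = q j) :
    dist1 z q = (q i - z i).natAbs := by
  unfold dist1
  rw [← Finset.add_sum_erase _ _ (Finset.mem_univ i), Finset.sum_eq_zero, add_zero]
  intro j hj
  rw [h j (Finset.ne_of_mem_erase hj), sub_self, Int.natAbs_zero]

/-- A point with vanishing transverse coordinates is a multiple of the axis vector. [folklore] -/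
theorem eq_single_of_transverse {i : Fin (d + 2)} {z : Site (d + 2)} (h : ∀ j, j ≠ i → z j = 0) :
    z = Pi.single i (z i) := by
  funext j
  by_cases hj : j = i
  · subst hj; simp
  · rw [h j hj, Pi.single_eq_of_ne hj]

/-- Along a greedy path between points that agree off `i`, all points agree with them off `i`.
[folklore] -/
theorem gpath_transverse {i : Fin (d + 2)} {p q : Site (d + 2)} (h : ∀ j, j ≠ i → p j = q j)
    (t : ℕ) : ∀ j, j ≠ i → gpath p q t j = q j := fun j hj => by
  rw [gpath_apply_of_eq (h j hj), h j hj]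

/-- Along a greedy path between points that agree off `i`, the level is at distance `ℓ - t` from
the target level at time `t ≤ ℓ`. [folklore] -/
theorem gpath_level_dist {i : Fin (d + 2)} {p q : Site (d + 2)} (h : ∀ j, j ≠ i → p j = q j)
    {t : ℕ} (ht : t ≤ dist1 p q) : (q i - gpath p q t i).natAbs = dist1 p q - t := by
  rw [← dist1_of_agree (gpath_transverse h t), dist1_gpath p q t ht]

/-- An outer-layer point whose transverse coordinates are small has extreme level. [folklore] -/
theorem level_eq_of_transverse_small {i : Fin (d + 2)} {x : Site (d + 2)}
    (hxL : ∃ j, |x j| = 13) (h : ∀ j, j ≠ i → |x j| ≤ 12) : |x i| = 13 := by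
  obtain ⟨j, hj⟩ := hxL
  by_cases hji : j = i
  · rw [← hji]; exact hj
  · have := h j hji; omega

/-! #### The seven pieces of the route -/

/-- `x⁻`: the point `x` pushed down to the face `zᵢ = -13`. [folklore] -/
def dropPt (i : Fin (d + 2)) (x : Site (d + 2)) : Site (d + 2) := Function.update x i (-13)

/-- `y⁺`: the point `y` pushed up to the face `zᵢ = 13`. [folklore] -/
def liftPt (i : Fin (d + 2)) (y : Site (d + 2)) : Site (d + 2) := Function.update y i 13

/-- The route in the case `xᵢ < yᵢ`: segment down from `x`, greedy path in the bottom face to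
its centre, axis up to the gadget, the gadget, axis up to the top face centre, greedy path in
the top face, segment down to `y`. [folklore] -/
def routeUp (i : Fin (d + 2)) (x y : Site (d + 2)) : ℕ → Site (d + 2) :=
  let x' := dropPt i x
  let y' := liftPt i y
  let pL : Site (d + 2) := Pi.single i (-13)
  let pH : Site (d + 2) := Pi.single i 13
  let aL : Site (d + 2) := Pi.single i (gadgetLo i)
  let aH : Site (d + 2) := Pi.single i (gadgetHi i)
  let m1 := dist1 x x'
  let m2 := m1 + dist1 x' pL
  let m3 := m2 + dist1 pL aL
  let m4 := m3 + gadgetLen i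
  let m5 := m4 + dist1 aH pH
  let m6 := m5 + dist1 pH y'
  pappend m6 (pappend m5 (pappend m4 (pappend m3 (pappend m2 (pappend m1
    (gpath x x') (gpath x' pL)) (gpath pL aL)) (gadgetWalk i)) (gpath aH pH)) (gpath pH y'))
    (gpath y' y)

/-- The length of `routeUp`. [folklore] -/
def routeUpLen (i : Fin (d + 2)) (x y : Site (d + 2)) : ℕ :=
  dist1 x (dropPt i x) + dist1 (dropPt i x) (Pi.single i (-13)) +
    dist1 (Pi.single i (-13) : Site (d + 2)) (Pi.single i (gadgetLo i)) + gadgetLen i +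
    dist1 (Pi.single i (gadgetHi i) : Site (d + 2)) (Pi.single i 13) +
    dist1 (Pi.single i 13) (liftPt i y) + dist1 (liftPt i y) y

end Route

/-! #### Levels along single-coordinate greedy paths -/

section Levels

variable {d : ℕ}

/-- Exact level along a greedy path that only raises the coordinate `i`. [folklore] -/
theorem gpath_level_of_le {i : Fin (d + 2)} {p q : Site (d + 2)} (h : ∀ j, j ≠ i → p j = q j)
    (hpq : p i ≤ q i) {t : ℕ} (ht : t ≤ dist1 p q) :
    gpath p q t i = q i - ((dist1 p q - t : ℕ) : ℤ) := by
  have h1 := gpath_level_dist h ht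
  have h2 := (gpath_apply_mem p q i t).2
  rw [max_eq_right hpq] at h2
  omega

/-- Exact level along a greedy path that only lowers the coordinate `i`. [folklore] -/
theorem gpath_level_of_ge {i : Fin (d + 2)} {p q : Site (d + 2)} (h : ∀ j, j ≠ i → p j = q j)
    (hpq : q i ≤ p i) {t : ℕ} (ht : t ≤ dist1 p q) :
    gpath p q t i = q i + ((dist1 p q - t : ℕ) : ℤ) := by
  have h1 := gpath_level_dist h ht
  have h2 := (gpath_apply_mem p q i t).1
  rw [min_eq_right hpq] at h2
  omega

/-- The length of a single-coordinate greedy path. [folklore] -/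
theorem dist1_single_coord {i : Fin (d + 2)} {p q : Site (d + 2)} (h : ∀ j, j ≠ i → p j = q j) :
    (dist1 p q : ℤ) = |q i - p i| := by
  rw [dist1_of_agree h, Int.natCast_natAbs]

end Levels

/-! #### Point predicates for the pieces -/

section Predicates

variable {d : ℕ}

/-- Points of the cube of radius `13`. [folklore] -/
def InBox13 (z : Site (d + 2)) : Prop := ∀ j, |z j| ≤ 13

/-- Points of piece 1 (the segment below `x`). [folklore] -/
def PS1 (i : Fin (d + 2)) (x z : Site (d + 2)) : Prop :=
  (∀ j, j ≠ i → z j = x j) ∧ -13 ≤ z i ∧ z i ≤ x i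

/-- Points of the lower axis. [folklore] -/
def PAXlo (i : Fin (d + 2)) (z : Site (d + 2)) : Prop := (∀ j, j ≠ i → z j = 0) ∧ z i ≤ gadgetLo i

/-- Points of the gadget region. [folklore] -/
def PGD (i : Fin (d + 2)) (z : Site (d + 2)) : Prop :=
  gadgetLo i ≤ z i ∧ z i ≤ gadgetHi i ∧ ∀ j, |z j| ≤ 9

/-- Points of the upper axis. [folklore] -/
def PAXhi (i : Fin (d + 2)) (z : Site (d + 2)) : Prop := (∀ j, j ≠ i → z j = 0) ∧ gadgetHi i ≤ z i

/-- Points of piece 7 (the segment above `y`). [folklore] -/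
def PS7 (i : Fin (d + 2)) (y z : Site (d + 2)) : Prop :=
  (∀ j, j ≠ i → z j = y j) ∧ y i ≤ z i ∧ z i ≤ 13

/-- Points of the first `k` pieces, `k = 2, …, 6`. [folklore] -/
def PQ (k : ℕ) (i : Fin (d + 2)) (x z : Site (d + 2)) : Prop :=
  PS1 i x z ∨ z i = -13 ∨ (3 ≤ k ∧ PAXlo i z) ∨ (4 ≤ k ∧ PGD i z) ∨ (5 ≤ k ∧ PAXhi i z) ∨
    (6 ≤ k ∧ z i = 13)

/-- Monotonicity of the cumulative predicates. [folklore] -/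
theorem PQ.mono {k k' : ℕ} {i : Fin (d + 2)} {x z : Site (d + 2)} (h : PQ k i x z) (hk : k ≤ k') :
    PQ k' i x z := by
  rcases h with h | h | ⟨h1, h2⟩ | ⟨h1, h2⟩ | ⟨h1, h2⟩ | ⟨h1, h2⟩
  · exact Or.inl h
  · exact Or.inr (Or.inl h)
  · exact Or.inr (Or.inr (Or.inl ⟨by omega, h2⟩))
  · exact Or.inr (Or.inr (Or.inr (Or.inl ⟨by omega, h2⟩)))
  · exact Or.inr (Or.inr (Or.inr (Or.inr (Or.inl ⟨by omega, h2⟩))))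
  · exact Or.inr (Or.inr (Or.inr (Or.inr (Or.inr ⟨by omega, h2⟩))))

end Predicates

/-! #### The pieces one by one -/

section Pieces

variable {d : ℕ} (i : Fin (d + 2)) (x y : Site (d + 2))

/-- `x⁻` agrees with `x` off `i` and has level `-13`. [folklore] -/
theorem dropPt_spec : (∀ j, j ≠ i → x j = dropPt i x j) ∧ dropPt i x i = -13 := by
  refine ⟨fun j hj => ?_, by simp [dropPt]⟩
  simp [dropPt, Function.update_of_ne hj]

/-- `y⁺` agrees with `y` off `i` and has level `13`. [folklore] -/
theorem liftPt_spec : (∀ j, j ≠ i → liftPt i y j = y j) ∧ liftPt i y i = 13 := by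
  refine ⟨fun j hj => ?_, by simp [liftPt]⟩
  simp [liftPt, Function.update_of_ne hj]

/-- Piece 1: from `x` down to `x⁻`. [folklore] -/
theorem piece1_spec (hx : ∀ j, |x j| ≤ 13) (t : ℕ) :
    PS1 i x (gpath x (dropPt i x) t) ∧ InBox13 (gpath x (dropPt i x) t) ∧
      (t < dist1 x (dropPt i x) → -13 < gpath x (dropPt i x) t i) := by
  obtain ⟨hag, hlev⟩ := dropPt_spec i x
  have hxi : -13 ≤ x i := by have := hx i; rw [abs_le] at this; exact this.1
  have htr : ∀ j, j ≠ i → gpath x (dropPt i x) t j = x j := fun j hj => by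
    rw [gpath_apply_of_eq (hag j hj)]
  have hmem := gpath_apply_mem x (dropPt i x) i t
  rw [hlev, min_eq_right hxi, max_eq_left hxi] at hmem
  refine ⟨⟨htr, hmem.1, hmem.2⟩, fun j => ?_, fun ht => ?_⟩
  · by_cases hj : j = i
    · subst hj; rw [abs_le]; have := hx j; rw [abs_le] at this; exact ⟨hmem.1, hmem.2.trans this.2⟩
    · rw [htr j hj]; exact hx j
  · have := gpath_level_of_ge hag (by rw [hlev]; exact hxi) ht.le
    rw [hlev] at this
    omega

/-- Piece 2: inside the bottom face from `x⁻` to its centre. [folklore] -/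
theorem piece2_spec (hx : ∀ j, |x j| ≤ 13) (t : ℕ) :
    gpath (dropPt i x) (Pi.single i (-13)) t i = -13 ∧
      InBox13 (gpath (dropPt i x) (Pi.single i (-13)) t) := by
  obtain ⟨hag, hlev⟩ := dropPt_spec i x
  have h1 : gpath (dropPt i x) (Pi.single i (-13)) t i = -13 := by
    rw [gpath_apply_of_eq (by rw [hlev]; simp), hlev]
  refine ⟨h1, fun j => ?_⟩
  by_cases hj : j = i
  · subst hj; rw [h1]; norm_num
  · have hmem := gpath_apply_mem (dropPt i x) (Pi.single i (-13)) j t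
    rw [Pi.single_eq_of_ne hj, ← hag j hj] at hmem
    have := hx j
    rw [abs_le] at this ⊢
    exact ⟨le_trans (le_min this.1 (by norm_num)) hmem.1, le_trans hmem.2 (max_le this.2 (by norm_num))⟩

/-- The lower end level is below the gadget: `-13 < gadgetLo i`, and `gadgetHi i < 13`,
`gadgetLo i < gadgetHi i`, `gadgetHi i ≤ 9`, `-9 ≤ gadgetLo i`. [folklore] -/
theorem gadgetLoHi_bounds : -9 ≤ gadgetLo i ∧ gadgetLo i < gadgetHi i ∧ gadgetHi i ≤ 9 := by
  unfold gadgetLo gadgetHi; split_ifs <;> norm_num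

/-- Piece 3: the lower axis from the bottom face centre up to the gadget entry. [folklore] -/
theorem piece3_spec (t : ℕ) (ht : t ≤ dist1 (Pi.single i (-13) : Site (d + 2)) (Pi.single i (gadgetLo i))) :
    (∀ j, j ≠ i → gpath (Pi.single i (-13) : Site (d + 2)) (Pi.single i (gadgetLo i)) t j = 0) ∧
      gpath (Pi.single i (-13) : Site (d + 2)) (Pi.single i (gadgetLo i)) t i =
        gadgetLo i - ((dist1 (Pi.single i (-13) : Site (d + 2)) (Pi.single i (gadgetLo i)) - t : ℕ) : ℤ) ∧
      (dist1 (Pi.single i (-13) : Site (d + 2)) (Pi.single i (gadgetLo i)) : ℤ) = gadgetLo i + 13 := by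
  have hb := gadgetLoHi_bounds i
  have hag : ∀ j, j ≠ i → (Pi.single i (-13) : Site (d + 2)) j = (Pi.single i (gadgetLo i) : Site (d + 2)) j :=
    fun j hj => by rw [Pi.single_eq_of_ne hj, Pi.single_eq_of_ne hj]
  refine ⟨fun j hj => ?_, ?_, ?_⟩
  · rw [gpath_transverse hag t j hj, Pi.single_eq_of_ne hj]
  · have := gpath_level_of_le hag (by simp only [Pi.single_eq_same]; omega) ht
    simpa using this
  · rw [dist1_single_coord hag]; simp only [Pi.single_eq_same]; rw [abs_of_nonneg (by omega)]; ring

/-- Piece 5: the upper axis from the gadget exit to the top face centre. [folklore] -/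
theorem piece5_spec (t : ℕ) (ht : t ≤ dist1 (Pi.single i (gadgetHi i) : Site (d + 2)) (Pi.single i 13)) :
    (∀ j, j ≠ i → gpath (Pi.single i (gadgetHi i) : Site (d + 2)) (Pi.single i 13) t j = 0) ∧
      gpath (Pi.single i (gadgetHi i) : Site (d + 2)) (Pi.single i 13) t i =
        13 - ((dist1 (Pi.single i (gadgetHi i) : Site (d + 2)) (Pi.single i 13) - t : ℕ) : ℤ) ∧
      (dist1 (Pi.single i (gadgetHi i) : Site (d + 2)) (Pi.single i 13) : ℤ) = 13 - gadgetHi i := by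
  have hb := gadgetLoHi_bounds i
  have hag : ∀ j, j ≠ i → (Pi.single i (gadgetHi i) : Site (d + 2)) j = (Pi.single i 13 : Site (d + 2)) j :=
    fun j hj => by rw [Pi.single_eq_of_ne hj, Pi.single_eq_of_ne hj]
  refine ⟨fun j hj => ?_, ?_, ?_⟩
  · rw [gpath_transverse hag t j hj, Pi.single_eq_of_ne hj]
  · have := gpath_level_of_le hag (by simp only [Pi.single_eq_same]; omega) ht
    simpa using this
  · rw [dist1_single_coord hag]; simp only [Pi.single_eq_same]; rw [abs_of_nonneg (by omega)]

/-- Piece 6: inside the top face from its centre to `y⁺`. [folklore] -/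
theorem piece6_spec (hy : ∀ j, |y j| ≤ 13) (t : ℕ) :
    gpath (Pi.single i 13) (liftPt i y) t i = 13 ∧ InBox13 (gpath (Pi.single i 13) (liftPt i y) t) := by
  obtain ⟨hag, hlev⟩ := liftPt_spec i y
  have h1 : gpath (Pi.single i 13) (liftPt i y) t i = 13 := by
    rw [gpath_apply_of_eq (by rw [hlev]; simp)]; simp
  refine ⟨h1, fun j => ?_⟩
  by_cases hj : j = i
  · subst hj; rw [h1]; norm_num
  · have hmem := gpath_apply_mem (Pi.single i 13 : Site (d + 2)) (liftPt i y) j t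
    rw [Pi.single_eq_of_ne hj, hag j hj] at hmem
    have := hy j
    rw [abs_le] at this ⊢
    exact ⟨le_trans (le_min (by norm_num) this.1) hmem.1, le_trans hmem.2 (max_le (by norm_num) this.2)⟩

/-- Piece 7: from `y⁺` down to `y`. [folklore] -/
theorem piece7_spec (hy : ∀ j, |y j| ≤ 13) (t : ℕ) (ht : t ≤ dist1 (liftPt i y) y) :
    PS7 i y (gpath (liftPt i y) y t) ∧ InBox13 (gpath (liftPt i y) y t) ∧
      gpath (liftPt i y) y t i = y i + ((dist1 (liftPt i y) y - t : ℕ) : ℤ) ∧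
      (dist1 (liftPt i y) y : ℤ) = 13 - y i := by
  obtain ⟨hag, hlev⟩ := liftPt_spec i y
  have hyi : y i ≤ 13 := by have := hy i; rw [abs_le] at this; exact this.2
  have htr : ∀ j, j ≠ i → gpath (liftPt i y) y t j = y j := fun j hj => by
    rw [gpath_apply_of_eq (hag j hj), hag j hj]
  have hform := gpath_level_of_ge hag (by rw [hlev]; exact hyi) ht
  have hdist : (dist1 (liftPt i y) y : ℤ) = 13 - y i := by
    rw [dist1_single_coord hag, hlev, abs_of_nonpos (by omega)]; ring
  have hmem := gpath_apply_mem (liftPt i y) y i t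
  rw [hlev, min_eq_right hyi, max_eq_left hyi] at hmem
  refine ⟨⟨htr, hmem.1, hmem.2⟩, fun j => ?_, hform, hdist⟩
  by_cases hj : j = i
  · subst hj; rw [abs_le]; have := hy j; rw [abs_le] at this; exact ⟨this.1.trans hmem.1, hmem.2⟩
  · rw [htr j hj]; exact hy j

end Pieces

/-! #### The cumulative walks `A₁ ⊂ A₂ ⊂ ⋯ ⊂ A₇ = routeUp` -/

section Cumulative

variable {d : ℕ} (i : Fin (d + 2)) (x y : Site (d + 2))

/-- Length after piece 1. [folklore] -/
def m1 : ℕ := dist1 x (dropPt i x)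
/-- Length after piece 2. [folklore] -/
def m2 : ℕ := m1 i x + dist1 (dropPt i x) (Pi.single i (-13))
/-- Length after piece 3. [folklore] -/
def m3 : ℕ := m2 i x + dist1 (Pi.single i (-13) : Site (d + 2)) (Pi.single i (gadgetLo i))
/-- Length after piece 4. [folklore] -/
def m4 : ℕ := m3 i x + gadgetLen i
/-- Length after piece 5. [folklore] -/
def m5 : ℕ := m4 i x + dist1 (Pi.single i (gadgetHi i) : Site (d + 2)) (Pi.single i 13)
/-- Length after piece 6. [folklore] -/
def m6 : ℕ := m5 i x + dist1 (Pi.single i 13) (liftPt i y)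
/-- Length after piece 7 (the length of `routeUp`). [folklore] -/
def m7 : ℕ := m6 i x y + dist1 (liftPt i y) y

/-- `A₁`. [folklore] -/
def A1 : ℕ → Site (d + 2) := gpath x (dropPt i x)
/-- `A₂`. [folklore] -/
def A2 : ℕ → Site (d + 2) := pappend (m1 i x) (A1 i x) (gpath (dropPt i x) (Pi.single i (-13)))
/-- `A₃`. [folklore] -/
def A3 : ℕ → Site (d + 2) :=
  pappend (m2 i x) (A2 i x) (gpath (Pi.single i (-13) : Site (d + 2)) (Pi.single i (gadgetLo i)))
/-- `A₄`. [folklore] -/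
def A4 : ℕ → Site (d + 2) := pappend (m3 i x) (A3 i x) (gadgetWalk i)
/-- `A₅`. [folklore] -/
def A5 : ℕ → Site (d + 2) :=
  pappend (m4 i x) (A4 i x) (gpath (Pi.single i (gadgetHi i) : Site (d + 2)) (Pi.single i 13))
/-- `A₆`. [folklore] -/
def A6 : ℕ → Site (d + 2) := pappend (m5 i x) (A5 i x) (gpath (Pi.single i 13) (liftPt i y))
/-- `A₇`. [folklore] -/
def A7 : ℕ → Site (d + 2) := pappend (m6 i x y) (A6 i x y) (gpath (liftPt i y) y)

/-- `routeUp = A₇` and `routeUpLen = m₇`. [folklore] -/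
theorem routeUp_eq : routeUp i x y = A7 i x y ∧ routeUpLen i x y = m7 i x y := ⟨rfl, rfl⟩

variable {i x y}

/-- If the transverse coordinates of `x` are small then `xᵢ = -13`. [folklore] -/
theorem xi_eq_of_small (hxL : ∃ j, |x j| = 13) (hy : ∀ j, |y j| ≤ 13) (hlt : x i < y i)
    (h : ∀ j, j ≠ i → |x j| ≤ 12) : x i = -13 := by
  have h1 := level_eq_of_transverse_small hxL h
  have h2 := hy i
  rw [abs_le] at h2
  rcases (abs_eq (by norm_num : (0 : ℤ) ≤ 13)).1 h1 with h3 | h3 <;> omega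

/-- If the transverse coordinates of `y` are small then `yᵢ = 13`. [folklore] -/
theorem yi_eq_of_small (hx : ∀ j, |x j| ≤ 13) (hyL : ∃ j, |y j| = 13) (hlt : x i < y i)
    (h : ∀ j, j ≠ i → |y j| ≤ 12) : y i = 13 := by
  have h1 := level_eq_of_transverse_small hyL h
  have h2 := hx i
  rw [abs_le] at h2
  rcases (abs_eq (by norm_num : (0 : ℤ) ≤ 13)).1 h1 with h3 | h3 <;> omega

/-- `A₁`: path, endpoints, points. [folklore] -/
theorem A1_spec (hx : ∀ j, |x j| ≤ 13) :
    PathOn (m1 i x) (A1 i x) ∧ A1 i x 0 = x ∧ A1 i x (m1 i x) = dropPt i x ∧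
    ∀ t ≤ m1 i x, PQ 1 i x (A1 i x t) ∧ InBox13 (A1 i x t) := by
  refine ⟨pathOn_gpath _ _, rfl, gpath_of_ge _ _ le_rfl, fun t _ => ?_⟩
  have := piece1_spec i x hx t
  exact ⟨Or.inl this.1, this.2.1⟩

/-- `A₂`: path, endpoints, points. [folklore] -/
theorem A2_spec (hx : ∀ j, |x j| ≤ 13) :
    PathOn (m2 i x) (A2 i x) ∧ A2 i x 0 = x ∧ A2 i x (m2 i x) = Pi.single i (-13) ∧
    ∀ t ≤ m2 i x, PQ 2 i x (A2 i x t) ∧ InBox13 (A2 i x t) := by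
  obtain ⟨hP, h0, hend, hpts⟩ := A1_spec (i := i) hx
  have hj : A1 i x (m1 i x) = gpath (dropPt i x) (Pi.single i (-13)) 0 := by rw [hend]; rfl
  refine ⟨?_, ?_, ?_, ?_⟩
  · refine hP.append (pathOn_gpath _ _) hj fun s hs t ht1 ht2 heq => ?_
    have h1 := (piece1_spec i x hx s).2.2 hs
    have h2 := (piece2_spec i x hx t).1
    have := congrFun heq i
    simp only [A1] at this
    rw [this, h2] at h1
    exact lt_irrefl _ h1
  · unfold A2; rw [pappend_of_le _ _ (Nat.zero_le _), h0]
  · unfold A2 m2; rw [pappend_add _ _ _ _ hj, gpath_of_ge _ _ le_rfl]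
  · intro t ht
    unfold A2
    rcases le_or_gt t (m1 i x) with h | h
    · rw [pappend_of_le _ _ h]; exact ⟨(hpts t h).1.mono (by norm_num), (hpts t h).2⟩
    · obtain ⟨k, rfl⟩ : ∃ k, t = m1 i x + k := ⟨t - m1 i x, by omega⟩
      rw [pappend_add _ _ _ _ hj]
      have := piece2_spec i x hx k
      exact ⟨Or.inr (Or.inl this.1), this.2⟩

/-- `A₃`: path, endpoints, points. [folklore] -/
theorem A3_spec (hx : ∀ j, |x j| ≤ 13) (hxL : ∃ j, |x j| = 13) (hy : ∀ j, |y j| ≤ 13) (hlt : x i < y i) :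
    PathOn (m3 i x) (A3 i x) ∧ A3 i x 0 = x ∧ A3 i x (m3 i x) = Pi.single i (gadgetLo i) ∧
    ∀ t ≤ m3 i x, PQ 3 i x (A3 i x t) ∧ InBox13 (A3 i x t) := by
  obtain ⟨hP, h0, hend, hpts⟩ := A2_spec (i := i) hx
  have hb := gadgetLoHi_bounds i
  have hj : A2 i x (m2 i x) = (gpath (Pi.single i (-13) : Site (d + 2)) (Pi.single i (gadgetLo i))) 0 := by rw [hend]; rfl
  -- points of piece 3
  have p3 : ∀ t ≤ (dist1 (Pi.single i (-13) : Site (d + 2)) (Pi.single i (gadgetLo i))), (∀ j, j ≠ i → (gpath (Pi.single i (-13) : Site (d + 2)) (Pi.single i (gadgetLo i))) t j = 0) ∧ (gpath (Pi.single i (-13) : Site (d + 2)) (Pi.single i (gadgetLo i))) t i = (t : ℤ) - 13 := by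
    intro t ht
    obtain ⟨htr, hlev, hlen⟩ := piece3_spec i t ht
    refine ⟨htr, ?_⟩
    rw [hlev]; push_cast [Nat.cast_sub ht]; linarith
  refine ⟨?_, ?_, ?_, ?_⟩
  · refine hP.append (pathOn_gpath _ _) hj fun s hs t ht1 ht2 heq => ?_
    have hz := (hpts s hs.le).1
    obtain ⟨htr, hlev⟩ := p3 t ht2
    have hlevz : A2 i x s i = (t : ℤ) - 13 := by rw [heq]; exact hlev
    rcases hz with hz | hz | ⟨h, -⟩ | ⟨h, -⟩ | ⟨h, -⟩ | ⟨h, -⟩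
    · -- piece-1 point: its transverse coordinates vanish, so `x i = -13`
      have hsmall : ∀ j, j ≠ i → |x j| ≤ 12 := fun j hj => by
        rw [← hz.1 j hj, heq, htr j hj]; norm_num
      have := xi_eq_of_small hxL hy hlt hsmall
      have h3 := hz.2.2
      omega
    · omega
    · omega
    · omega
    · omega
    · omega
  · unfold A3; rw [pappend_of_le _ _ (Nat.zero_le _), h0]
  · unfold A3 m3; rw [pappend_add _ _ _ _ hj, gpath_of_ge _ _ le_rfl]
  · intro t ht
    unfold A3
    rcases le_or_gt t (m2 i x) with h | h
    · rw [pappend_of_le _ _ h]; exact ⟨(hpts t h).1.mono (by norm_num), (hpts t h).2⟩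
    · obtain ⟨k, rfl⟩ : ∃ k, t = m2 i x + k := ⟨t - m2 i x, by omega⟩
      have hk : k ≤ (dist1 (Pi.single i (-13) : Site (d + 2)) (Pi.single i (gadgetLo i))) := by unfold m3 at ht; omega
      rw [pappend_add _ _ _ _ hj]
      obtain ⟨htr, hlev⟩ := p3 k hk
      have hlen : ((dist1 (Pi.single i (-13) : Site (d + 2)) (Pi.single i (gadgetLo i))) : ℤ) = gadgetLo i + 13 := (piece3_spec i k hk).2.2
      refine ⟨Or.inr (Or.inr (Or.inl ⟨le_rfl, htr, by rw [hlev]; omega⟩)), fun j => ?_⟩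
      by_cases hji : j = i
      · subst hji; rw [hlev, abs_le]; constructor <;> omega
      · rw [htr j hji]; norm_num

/-- `A₄`: path, endpoints, points. [folklore] -/
theorem A4_spec (hx : ∀ j, |x j| ≤ 13) (hxL : ∃ j, |x j| = 13) (hy : ∀ j, |y j| ≤ 13) (hlt : x i < y i) :
    PathOn (m4 i x) (A4 i x) ∧ A4 i x 0 = x ∧ A4 i x (m4 i x) = Pi.single i (gadgetHi i) ∧
    ∀ t ≤ m4 i x, PQ 4 i x (A4 i x t) ∧ InBox13 (A4 i x t) := by
  obtain ⟨hP, h0, hend, hpts⟩ := A3_spec (i := i) hx hxL hy hlt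
  have hb := gadgetLoHi_bounds i
  have hj : A3 i x (m3 i x) = gadgetWalk i 0 := by rw [hend, gadgetWalk_zero]
  refine ⟨?_, ?_, ?_, ?_⟩
  · refine hP.append (pathOn_gadgetWalk i) hj fun s hs t ht1 ht2 heq => ?_
    have hz := (hpts s hs.le).1
    obtain ⟨⟨hglo, hghi⟩, hgabs⟩ := gadgetWalk_ranges i ht2
    rcases hz with hz | hz | ⟨-, hz⟩ | ⟨h, -⟩ | ⟨h, -⟩ | ⟨h, -⟩
    · have hsmall : ∀ j, j ≠ i → |x j| ≤ 12 := fun j hj => by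
        rw [← hz.1 j hj, heq]; exact (hgabs j).trans (by norm_num)
      have := xi_eq_of_small hxL hy hlt hsmall
      have h3 := hz.2.2
      rw [heq] at h3
      omega
    · rw [heq] at hz; omega
    · -- lower-axis point: it must be the gadget entry, excluded by injectivity
      have hlev : gadgetWalk i t i = gadgetLo i := by
        have := hz.2; rw [heq] at this; omega
      have htr : ∀ j, j ≠ i → gadgetWalk i t j = 0 := fun j hj => by rw [← heq]; exact hz.1 j hj
      have heq' : gadgetWalk i t = gadgetWalk i 0 := by
        rw [eq_single_of_transverse htr, hlev, gadgetWalk_zero]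
      have := (pathOn_gadgetWalk i).2 (show t ≤ gadgetLen i from ht2) (Nat.zero_le _) heq'
      omega
    · omega
    · omega
    · omega
  · unfold A4; rw [pappend_of_le _ _ (Nat.zero_le _), h0]
  · unfold A4 m4; rw [pappend_add _ _ _ _ hj, gadgetWalk_len]
  · intro t ht
    unfold A4
    rcases le_or_gt t (m3 i x) with h | h
    · rw [pappend_of_le _ _ h]; exact ⟨(hpts t h).1.mono (by norm_num), (hpts t h).2⟩
    · obtain ⟨k, rfl⟩ : ∃ k, t = m3 i x + k := ⟨t - m3 i x, by omega⟩
      have hk : k ≤ gadgetLen i := by unfold m4 at ht; omega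
      rw [pappend_add _ _ _ _ hj]
      obtain ⟨⟨hglo, hghi⟩, hgabs⟩ := gadgetWalk_ranges i hk
      exact ⟨Or.inr (Or.inr (Or.inr (Or.inl ⟨le_rfl, hglo, hghi, hgabs⟩))),
        fun j => (hgabs j).trans (by norm_num)⟩

/-- `A₅`: path, endpoints, points. [folklore] -/
theorem A5_spec (hx : ∀ j, |x j| ≤ 13) (hxL : ∃ j, |x j| = 13) (hy : ∀ j, |y j| ≤ 13) (hlt : x i < y i) :
    PathOn (m5 i x) (A5 i x) ∧ A5 i x 0 = x ∧ A5 i x (m5 i x) = Pi.single i 13 ∧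
    ∀ t ≤ m5 i x, PQ 5 i x (A5 i x t) ∧ InBox13 (A5 i x t) := by
  obtain ⟨hP, h0, hend, hpts⟩ := A4_spec (i := i) hx hxL hy hlt
  have hb := gadgetLoHi_bounds i
  have hj : A4 i x (m4 i x) = (gpath (Pi.single i (gadgetHi i) : Site (d + 2)) (Pi.single i 13)) 0 := by rw [hend]; rfl
  have p5 : ∀ t ≤ (dist1 (Pi.single i (gadgetHi i) : Site (d + 2)) (Pi.single i 13)), (∀ j, j ≠ i → (gpath (Pi.single i (gadgetHi i) : Site (d + 2)) (Pi.single i 13)) t j = 0) ∧ (gpath (Pi.single i (gadgetHi i) : Site (d + 2)) (Pi.single i 13)) t i = gadgetHi i + t := by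
    intro t ht
    obtain ⟨htr, hlev, hlen⟩ := piece5_spec i t ht
    refine ⟨htr, ?_⟩
    rw [hlev]; push_cast [Nat.cast_sub ht]; linarith
  refine ⟨?_, ?_, ?_, ?_⟩
  · refine hP.append (pathOn_gpath _ _) hj fun s hs t ht1 ht2 heq => ?_
    have hz := (hpts s hs.le).1
    obtain ⟨htr, hlev⟩ := p5 t ht2
    have hlevz : A4 i x s i = gadgetHi i + t := by rw [heq]; exact hlev
    rcases hz with hz | hz | ⟨-, hz⟩ | ⟨-, hz⟩ | ⟨h, -⟩ | ⟨h, -⟩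
    · have hsmall : ∀ j, j ≠ i → |x j| ≤ 12 := fun j hj => by
        rw [← hz.1 j hj, heq, htr j hj]; norm_num
      have := xi_eq_of_small hxL hy hlt hsmall
      have h3 := hz.2.2
      omega
    · omega
    · have := hz.2; omega
    · have := hz.2.1; omega
    · omega
    · omega
  · unfold A5; rw [pappend_of_le _ _ (Nat.zero_le _), h0]
  · unfold A5 m5; rw [pappend_add _ _ _ _ hj, gpath_of_ge _ _ le_rfl]
  · intro t ht
    unfold A5
    rcases le_or_gt t (m4 i x) with h | h
    · rw [pappend_of_le _ _ h]; exact ⟨(hpts t h).1.mono (by norm_num), (hpts t h).2⟩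
    · obtain ⟨k, rfl⟩ : ∃ k, t = m4 i x + k := ⟨t - m4 i x, by omega⟩
      have hk : k ≤ (dist1 (Pi.single i (gadgetHi i) : Site (d + 2)) (Pi.single i 13)) := by unfold m5 at ht; omega
      rw [pappend_add _ _ _ _ hj]
      obtain ⟨htr, hlev⟩ := p5 k hk
      have hlen : ((dist1 (Pi.single i (gadgetHi i) : Site (d + 2)) (Pi.single i 13)) : ℤ) = 13 - gadgetHi i := (piece5_spec i k hk).2.2
      refine ⟨Or.inr (Or.inr (Or.inr (Or.inr (Or.inl ⟨le_rfl, htr, by rw [hlev]; omega⟩)))), fun j => ?_⟩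
      by_cases hji : j = i
      · subst hji; rw [hlev, abs_le]; constructor <;> omega
      · rw [htr j hji]; norm_num

/-- `A₆`: path, endpoints, points. [folklore] -/
theorem A6_spec (hx : ∀ j, |x j| ≤ 13) (hxL : ∃ j, |x j| = 13) (hy : ∀ j, |y j| ≤ 13) (hlt : x i < y i) :
    PathOn (m6 i x y) (A6 i x y) ∧ A6 i x y 0 = x ∧ A6 i x y (m6 i x y) = liftPt i y ∧
    ∀ t ≤ m6 i x y, PQ 6 i x (A6 i x y t) ∧ InBox13 (A6 i x y t) := by
  obtain ⟨hP, h0, hend, hpts⟩ := A5_spec (i := i) hx hxL hy hlt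
  have hb := gadgetLoHi_bounds i
  have hyi : y i ≤ 13 := by have := hy i; rw [abs_le] at this; exact this.2
  have hj : A5 i x (m5 i x) = (gpath (Pi.single i 13 : Site (d + 2)) (liftPt i y)) 0 := by rw [hend]; rfl
  refine ⟨?_, ?_, ?_, ?_⟩
  · refine hP.append (pathOn_gpath _ _) hj fun s hs t ht1 ht2 heq => ?_
    have hz := (hpts s hs.le).1
    have hlev := (piece6_spec i y hy t).1
    have hlevz : A5 i x s i = 13 := by rw [heq]; exact hlev
    rcases hz with hz | hz | ⟨-, hz⟩ | ⟨-, hz⟩ | ⟨-, hz⟩ | ⟨h, -⟩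
    · have := hz.2.2; omega
    · omega
    · have := hz.2; omega
    · have := hz.2.1; omega
    · -- upper-axis point at level 13: it is the top face centre `(gpath (Pi.single i 13 : Site (d + 2)) (liftPt i y)) 0`, excluded by injectivity
      have heq' : (gpath (Pi.single i 13 : Site (d + 2)) (liftPt i y)) t = (gpath (Pi.single i 13 : Site (d + 2)) (liftPt i y)) 0 := by
        rw [← heq, eq_single_of_transverse hz.1, hlevz]; rfl
      have := (pathOn_gpath (Pi.single i 13 : Site (d + 2)) (liftPt i y)).2
        (show t ≤ _ from ht2) (Nat.zero_le _) heq'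
      omega
    · omega
  · unfold A6; rw [pappend_of_le _ _ (Nat.zero_le _), h0]
  · unfold A6 m6; rw [pappend_add _ _ _ _ hj, gpath_of_ge _ _ le_rfl]
  · intro t ht
    unfold A6
    rcases le_or_gt t (m5 i x) with h | h
    · rw [pappend_of_le _ _ h]; exact ⟨(hpts t h).1.mono (by norm_num), (hpts t h).2⟩
    · obtain ⟨k, rfl⟩ : ∃ k, t = m5 i x + k := ⟨t - m5 i x, by omega⟩
      rw [pappend_add _ _ _ _ hj]
      have := piece6_spec i y hy k
      exact ⟨Or.inr (Or.inr (Or.inr (Or.inr (Or.inr ⟨le_rfl, this.1⟩)))), this.2⟩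

/-- `A₇ = routeUp`: path, endpoints, points. [folklore] -/
theorem A7_spec (hx : ∀ j, |x j| ≤ 13) (hxL : ∃ j, |x j| = 13) (hy : ∀ j, |y j| ≤ 13)
    (hyL : ∃ j, |y j| = 13) (hlt : x i < y i) :
    PathOn (m7 i x y) (A7 i x y) ∧ A7 i x y 0 = x ∧ A7 i x y (m7 i x y) = y ∧
    ∀ t ≤ m7 i x y, (PQ 6 i x (A7 i x y t) ∨ PS7 i y (A7 i x y t)) ∧ InBox13 (A7 i x y t) := by
  obtain ⟨hP, h0, hend, hpts⟩ := A6_spec (i := i) hx hxL hy hlt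
  have hb := gadgetLoHi_bounds i
  have hxi : -13 ≤ x i := by have := hx i; rw [abs_le] at this; exact this.1
  have hj : A6 i x y (m6 i x y) = (gpath (liftPt i y) y) 0 := by rw [hend]; rfl
  refine ⟨?_, ?_, ?_, ?_⟩
  · refine hP.append (pathOn_gpath _ _) hj fun s hs t ht1 ht2 heq => ?_
    have hz := (hpts s hs.le).1
    obtain ⟨hps7, -, hlev, hlen⟩ := piece7_spec i y hy t ht2
    have hlevz : A6 i x y s i = 13 - (t : ℤ) := by
      rw [heq, hlev]; push_cast [Nat.cast_sub ht2]; linarith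
    have hysmall : (∀ j, j ≠ i → |y j| ≤ 12) → False := fun hsm => by
      have := yi_eq_of_small hx hyL hlt hsm
      have : ((dist1 (liftPt i y) y) : ℤ) = 0 := by rw [hlen]; omega
      omega
    rcases hz with hz | hz | ⟨-, hz⟩ | ⟨-, hz⟩ | ⟨-, hz⟩ | ⟨-, hz⟩
    · have := hz.2.2
      have h2 := hps7.2.1
      rw [← heq] at h2
      omega
    · have h2 := hps7.2.1; rw [← heq] at h2; omega
    · exact hysmall fun j hj => by rw [← hps7.1 j hj, ← heq, hz.1 j hj]; norm_num
    · exact hysmall fun j hj => by rw [← hps7.1 j hj, ← heq]; exact (hz.2.2 j).trans (by norm_num)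
    · exact hysmall fun j hj => by rw [← hps7.1 j hj, ← heq, hz.1 j hj]; norm_num
    · omega
  · unfold A7; rw [pappend_of_le _ _ (Nat.zero_le _), h0]
  · unfold A7 m7; rw [pappend_add _ _ _ _ hj, gpath_of_ge _ _ le_rfl]
  · intro t ht
    unfold A7
    rcases le_or_gt t (m6 i x y) with h | h
    · rw [pappend_of_le _ _ h]; exact ⟨Or.inl (hpts t h).1, (hpts t h).2⟩
    · obtain ⟨k, rfl⟩ : ∃ k, t = m6 i x y + k := ⟨t - m6 i x y, by omega⟩
      have hk : k ≤ (dist1 (liftPt i y) y) := by unfold m7 at ht; omega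
      rw [pappend_add _ _ _ _ hj]
      have := piece7_spec i y hy k hk
      exact ⟨Or.inr this.1, this.2.1⟩

end Cumulative

/-! #### The `V`-occurrence on the route -/

section RouteOcc

variable {d : ℕ} {i : Fin (d + 2)} {x y : Site (d + 2)}

/-- Evaluation of `A₇` on the first three pieces. [folklore] -/
theorem A7_eq_A3 {t : ℕ} (ht : t ≤ m3 i x) : A7 i x y t = A3 i x t := by
  have h4 : m3 i x ≤ m4 i x := Nat.le_add_right _ _
  have h5 : m4 i x ≤ m5 i x := Nat.le_add_right _ _
  have h6 : m5 i x ≤ m6 i x y := Nat.le_add_right _ _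
  unfold A7 A6 A5 A4
  rw [pappend_of_le _ _ (by omega), pappend_of_le _ _ (by omega), pappend_of_le _ _ (by omega),
    pappend_of_le _ _ ht]

/-- Evaluation of `A₇` on the gadget. [folklore] -/
theorem A7_gadget (hx : ∀ j, |x j| ≤ 13) (hxL : ∃ j, |x j| = 13) (hy : ∀ j, |y j| ≤ 13)
    (hlt : x i < y i) {k : ℕ} (hk : k ≤ gadgetLen i) : A7 i x y (m3 i x + k) = gadgetWalk i k := by
  have h5 : m4 i x ≤ m5 i x := Nat.le_add_right _ _
  have h6 : m5 i x ≤ m6 i x y := Nat.le_add_right _ _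
  have hj : A3 i x (m3 i x) = gadgetWalk i 0 := by rw [(A3_spec hx hxL hy hlt).2.2.1, gadgetWalk_zero]
  have h4 : m3 i x + k ≤ m4 i x := by unfold m4; omega
  unfold A7 A6 A5 A4
  rw [pappend_of_le _ _ (by omega), pappend_of_le _ _ (by omega), pappend_of_le _ _ h4,
    pappend_add _ _ _ _ hj]

/-- Evaluation of `A₇` on piece 5. [folklore] -/
theorem A7_piece5 (hx : ∀ j, |x j| ≤ 13) (hxL : ∃ j, |x j| = 13) (hy : ∀ j, |y j| ≤ 13)
    (hlt : x i < y i) {k : ℕ}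
    (hk : k ≤ dist1 (Pi.single i (gadgetHi i) : Site (d + 2)) (Pi.single i 13)) :
    A7 i x y (m4 i x + k) = gpath (Pi.single i (gadgetHi i) : Site (d + 2)) (Pi.single i 13) k := by
  have h6 : m5 i x ≤ m6 i x y := Nat.le_add_right _ _
  have hj : A4 i x (m4 i x) = gpath (Pi.single i (gadgetHi i) : Site (d + 2)) (Pi.single i 13) 0 := by
    rw [(A4_spec hx hxL hy hlt).2.2.1]; rfl
  have h5 : m4 i x + k ≤ m5 i x := by unfold m5; omega
  unfold A7 A6 A5
  rw [pappend_of_le _ _ (by omega), pappend_of_le _ _ h5, pappend_add _ _ _ _ hj]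

/-- Evaluation of `A₇` on piece 6. [folklore] -/
theorem A7_piece6 (hx : ∀ j, |x j| ≤ 13) (hxL : ∃ j, |x j| = 13) (hy : ∀ j, |y j| ≤ 13)
    (hlt : x i < y i) {k : ℕ} (hk : k ≤ dist1 (Pi.single i 13) (liftPt i y)) :
    A7 i x y (m5 i x + k) = gpath (Pi.single i 13) (liftPt i y) k := by
  have hj : A5 i x (m5 i x) = gpath (Pi.single i 13) (liftPt i y) 0 := by
    rw [(A5_spec hx hxL hy hlt).2.2.1]; rfl
  unfold A7 A6
  rw [pappend_of_le _ _ (by unfold m6; omega), pappend_add _ _ _ _ hj]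

/-- Evaluation of `A₇` on piece 7. [folklore] -/
theorem A7_piece7 (hx : ∀ j, |x j| ≤ 13) (hxL : ∃ j, |x j| = 13) (hy : ∀ j, |y j| ≤ 13)
    (hlt : x i < y i) (k : ℕ) : A7 i x y (m6 i x y + k) = gpath (liftPt i y) y k := by
  have hj : A6 i x y (m6 i x y) = gpath (liftPt i y) y 0 := by
    rw [(A6_spec hx hxL hy hlt).2.2.1]; rfl
  unfold A7
  rw [pappend_add _ _ _ _ hj]

/-- **Cleanliness of a gadget cube along the whole route**: if a cube corner `w = gadgetWalk i k₀`
(`k₀ ≥ 1`) has level with `gadgetLo i ≤ wᵢ` and `wᵢ + 3 < gadgetHi i`, `|w j| ≤ 9`, and the gadget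
avoids the cube outside the window `[kw, kw + 11]` (with `k₀ ∈ [kw, kw+11]`), then so does the
route. [folklore] -/
theorem A7_avoid (hx : ∀ j, |x j| ≤ 13) (hxL : ∃ j, |x j| = 13) (hy : ∀ j, |y j| ≤ 13)
    (hyL : ∃ j, |y j| = 13) (hlt : x i < y i) {kw k₀ : ℕ} (hkw : kw + 11 ≤ gadgetLen i)
    (hk₀ : kw ≤ k₀) (hk₀' : k₀ ≤ kw + 11)
    (hclean : ∀ t ≤ gadgetLen i, (t < kw ∨ kw + 11 < t) →
      ¬ InCube (gadgetWalk i k₀) (gadgetWalk i t))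
    (hlevel : gadgetWalk i k₀ i + 3 < gadgetHi i) {t : ℕ} (ht : t ≤ m7 i x y)
    (hout : t < m3 i x + kw ∨ m3 i x + kw + 11 < t) :
    ¬ InCube (gadgetWalk i k₀) (A7 i x y t) := by
  have hb := gadgetLoHi_bounds i
  obtain ⟨⟨hwlo, hwhi⟩, hwabs⟩ := gadgetWalk_ranges i (show k₀ ≤ gadgetLen i by omega)
  -- consequences of being in the cube
  have cube_abs : ∀ z, InCube (gadgetWalk i k₀) z → ∀ j, |z j| ≤ 12 := fun z hz j => by
    have h1 := hz j; have h2 := hwabs j; rw [abs_le] at h2 ⊢; constructor <;> linarith [h1.1, h1.2]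
  have cube_lev : ∀ z, InCube (gadgetWalk i k₀) z → gadgetWalk i k₀ i ≤ z i ∧ z i < gadgetHi i :=
    fun z hz => by have := hz i; constructor <;> linarith [this.1, this.2]
  intro hC
  obtain ⟨hzlo, hzhi⟩ := cube_lev _ hC
  have hzabs := cube_abs _ hC
  rcases (show t < m3 i x ∨ (m3 i x ≤ t ∧ t ≤ m4 i x) ∨ (m4 i x < t ∧ t ≤ m5 i x) ∨
      (m5 i x < t ∧ t ≤ m6 i x y) ∨ m6 i x y < t by omega) with h | ⟨h1, h2⟩ | ⟨h1, h2⟩ | ⟨h1, h2⟩ | h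
  · -- first three pieces
    rw [A7_eq_A3 h.le] at hzlo hzhi hzabs hC
    obtain ⟨hP3, -, hend3, hpts3⟩ := A3_spec (y := y) hx hxL hy hlt
    rcases (hpts3 t h.le).1 with hz | hz | ⟨-, hz⟩ | ⟨h', -⟩ | ⟨h', -⟩ | ⟨h', -⟩
    · have hsmall : ∀ j, j ≠ i → |x j| ≤ 12 := fun j hj => by rw [← hz.1 j hj]; exact hzabs j
      have := xi_eq_of_small hxL hy hlt hsmall
      have := hz.2.2
      omega
    · omega
    · -- a lower-axis point in the cube has level `gadgetLo i`, hence is the gadget entry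
      have hlev : A3 i x t i = gadgetLo i := by have := hz.2; omega
      have heq : A3 i x t = A3 i x (m3 i x) := by
        rw [hend3, eq_single_of_transverse hz.1, hlev]
      have := hP3.2 (show t ≤ m3 i x from h.le) (show m3 i x ≤ m3 i x from le_rfl) heq
      omega
    · omega
    · omega
    · omega
  · -- the gadget itself
    obtain ⟨k, rfl⟩ : ∃ k, t = m3 i x + k := ⟨t - m3 i x, by omega⟩
    have hk : k ≤ gadgetLen i := by unfold m4 at h2; omega
    rw [A7_gadget hx hxL hy hlt hk] at hC
    exact hclean k hk (by omega) hC
  · -- piece 5: levels above `gadgetHi i`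
    obtain ⟨k, rfl⟩ : ∃ k, t = m4 i x + k := ⟨t - m4 i x, by omega⟩
    have hk : k ≤ dist1 (Pi.single i (gadgetHi i) : Site (d + 2)) (Pi.single i 13) := by
      unfold m5 at h2; omega
    rw [A7_piece5 hx hxL hy hlt hk] at hzhi
    obtain ⟨-, hlev, hlen⟩ := piece5_spec i k hk
    rw [hlev] at hzhi
    push_cast [Nat.cast_sub hk] at hzhi
    have : (1 : ℤ) ≤ k := by exact_mod_cast (show 1 ≤ k by omega)
    linarith
  · -- piece 6: level `13`
    obtain ⟨k, rfl⟩ : ∃ k, t = m5 i x + k := ⟨t - m5 i x, by omega⟩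
    have hk : k ≤ dist1 (Pi.single i 13) (liftPt i y) := by unfold m6 at h2; omega
    rw [A7_piece6 hx hxL hy hlt hk, (piece6_spec i y hy k).1] at hzhi
    omega
  · -- piece 7: only if `y i = 13`, and then the piece is trivial
    obtain ⟨k, rfl⟩ : ∃ k, t = m6 i x y + k := ⟨t - m6 i x y, by omega⟩
    have hk : k ≤ dist1 (liftPt i y) y := by unfold m7 at ht; omega
    rw [A7_piece7 hx hxL hy hlt k] at hzabs
    obtain ⟨hps7, -, -, hlen⟩ := piece7_spec i y hy k hk
    have hsmall : ∀ j, j ≠ i → |y j| ≤ 12 := fun j hj => by rw [← hps7.1 j hj]; exact hzabs j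
    have := yi_eq_of_small hx hyL hlt hsmall
    have : (dist1 (liftPt i y) y : ℤ) = 0 := by rw [hlen]; omega
    omega

/-- **The forward `V` on the route.** [folklore] -/
theorem A7_occV (hx : ∀ j, |x j| ≤ 13) (hxL : ∃ j, |x j| = 13) (hy : ∀ j, |y j| ≤ 13)
    (hyL : ∃ j, |y j| = 13) (hlt : x i < y i) :
    m3 i x + gadgetKV i + 11 ≤ m7 i x y ∧
    (∀ s ≤ 11, A7 i x y (m3 i x + gadgetKV i + s) = A7 i x y (m3 i x + gadgetKV i) + vPt s) ∧
    (∀ t ≤ m7 i x y, (t < m3 i x + gadgetKV i ∨ m3 i x + gadgetKV i + 11 < t) →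
      ¬ InCube (A7 i x y (m3 i x + gadgetKV i)) (A7 i x y t)) ∧
    (∀ z, InCube (A7 i x y (m3 i x + gadgetKV i)) z → ∀ j, |z j| ≤ 12) := by
  obtain ⟨hk, hseg, hclean, hlevel⟩ := gadget_occV i
  obtain ⟨-, -, -, -, h1⟩ := gadgetK_bounds i
  have hK : gadgetKV i ≤ gadgetLen i := by omega
  have hcorner : A7 i x y (m3 i x + gadgetKV i) = gadgetWalk i (gadgetKV i) := A7_gadget hx hxL hy hlt hK
  refine ⟨?_, fun s hs => ?_, fun t ht hout => ?_, fun z hz j => ?_⟩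
  · unfold m7 m6 m5 m4; omega
  · rw [hcorner, add_assoc, A7_gadget hx hxL hy hlt (by omega), hseg s hs]
  · rw [hcorner]
    exact A7_avoid hx hxL hy hyL hlt hk le_rfl (by omega) hclean hlevel ht (by omega)
  · rw [hcorner] at hz
    obtain ⟨-, hwabs⟩ := gadgetWalk_ranges i hK
    have h1 := hz j; have h2 := hwabs j; rw [abs_le] at h2 ⊢; constructor <;> linarith [h1.1, h1.2]

/-- **The backward `V` on the route.** [folklore] -/
theorem A7_occVrev (hx : ∀ j, |x j| ≤ 13) (hxL : ∃ j, |x j| = 13) (hy : ∀ j, |y j| ≤ 13)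
    (hyL : ∃ j, |y j| = 13) (hlt : x i < y i) :
    m3 i x + gadgetKR i + 11 ≤ m7 i x y ∧
    (∀ s ≤ 11, A7 i x y (m3 i x + gadgetKR i + s) = A7 i x y (m3 i x + gadgetKR i + 11) + vPt (11 - s)) ∧
    (∀ t ≤ m7 i x y, (t < m3 i x + gadgetKR i ∨ m3 i x + gadgetKR i + 11 < t) →
      ¬ InCube (A7 i x y (m3 i x + gadgetKR i + 11)) (A7 i x y t)) ∧
    (∀ z, InCube (A7 i x y (m3 i x + gadgetKR i + 11)) z → ∀ j, |z j| ≤ 12) := by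
  obtain ⟨hk, hseg, hclean, hlevel⟩ := gadget_occVrev i
  obtain ⟨-, -, -, -, h1⟩ := gadgetK_bounds i
  have hK : gadgetKR i + 11 ≤ gadgetLen i := hk
  have hcorner : A7 i x y (m3 i x + gadgetKR i + 11) = gadgetWalk i (gadgetKR i + 11) := by
    rw [add_assoc]; exact A7_gadget hx hxL hy hlt hK
  refine ⟨?_, fun s hs => ?_, fun t ht hout => ?_, fun z hz j => ?_⟩
  · unfold m7 m6 m5 m4; omega
  · rw [hcorner, add_assoc, A7_gadget hx hxL hy hlt (by omega), hseg s hs]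
  · rw [hcorner]
    exact A7_avoid hx hxL hy hyL hlt hk (by omega) le_rfl hclean hlevel ht (by omega)
  · rw [hcorner] at hz
    obtain ⟨-, hwabs⟩ := gadgetWalk_ranges i hK
    have h1 := hz j; have h2 := hwabs j; rw [abs_le] at h2 ⊢; constructor <;> linarith [h1.1, h1.2]

/-- Reading a backward `V` forwards along the reversed walk. [folklore] -/
theorem occ_of_rev {L k₁ : ℕ} {π : ℕ → Site (d + 2)} (hk : k₁ + 11 ≤ L)
    (hseg : ∀ s ≤ 11, π (k₁ + s) = π (k₁ + 11) + vPt (11 - s))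
    (havoid : ∀ t ≤ L, (t < k₁ ∨ k₁ + 11 < t) → ¬ InCube (π (k₁ + 11)) (π t)) :
    preverse L π (L - (k₁ + 11)) = π (k₁ + 11) ∧
    (∀ s ≤ 11, preverse L π (L - (k₁ + 11) + s) = preverse L π (L - (k₁ + 11)) + vPt s) ∧
    (∀ t ≤ L, (t < L - (k₁ + 11) ∨ L - (k₁ + 11) + 11 < t) →
      ¬ InCube (preverse L π (L - (k₁ + 11))) (preverse L π t)) := by
  have h0 : preverse L π (L - (k₁ + 11)) = π (k₁ + 11) := by
    simp only [preverse]; congr 1; omega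
  refine ⟨h0, fun s hs => ?_, fun t ht hout => ?_⟩
  · rw [h0]
    simp only [preverse]
    rw [show L - (L - (k₁ + 11) + s) = k₁ + (11 - s) by omega, hseg (11 - s) (by omega),
      show 11 - (11 - s) = s by omega]
  · rw [h0]
    simp only [preverse]
    exact havoid (L - t) (by omega) (by omega)

/-- The length of the route is bounded in terms of the dimension only. [folklore] -/
theorem dist1_le_of_inBox {z q : Site (d + 2)} (hz : InBox13 z) (hq : InBox13 q) :
    dist1 z q ≤ 26 * (d + 2) := by
  unfold dist1
  have : ∀ j, (q j - z j).natAbs ≤ 26 := fun j => by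
    have h1 := hz j; have h2 := hq j; rw [abs_le] at h1 h2; omega
  calc ∑ j, (q j - z j).natAbs ≤ ∑ _j : Fin (d + 2), 26 := Finset.sum_le_sum fun j _ => this j
    _ = 26 * (d + 2) := by simp [mul_comm]

/-- The length bound for `routeUp`. [folklore] -/
theorem m7_le (hx : ∀ j, |x j| ≤ 13) (hy : ∀ j, |y j| ≤ 13) : m7 i x y ≤ 156 * (d + 2) + 56 := by
  have hb := gadgetLoHi_bounds i
  have b1 : InBox13 x := hx
  have b2 : InBox13 (dropPt i x) := fun j => by
    by_cases hj : j = i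
    · subst hj; simp [dropPt]
    · rw [← (dropPt_spec i x).1 j hj]; exact hx j
  have b3 : InBox13 (Pi.single i (-13) : Site (d + 2)) := fun j => by
    by_cases hj : j = i
    · subst hj; simp
    · rw [Pi.single_eq_of_ne hj]; norm_num
  have b4 : InBox13 (Pi.single i (gadgetLo i) : Site (d + 2)) := fun j => by
    by_cases hj : j = i
    · subst hj; simp [abs_le]; omega
    · rw [Pi.single_eq_of_ne hj]; norm_num
  have b5 : InBox13 (Pi.single i (gadgetHi i) : Site (d + 2)) := fun j => by
    by_cases hj : j = i
    · subst hj; simp [abs_le]; omega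
    · rw [Pi.single_eq_of_ne hj]; norm_num
  have b6 : InBox13 (Pi.single i 13 : Site (d + 2)) := fun j => by
    by_cases hj : j = i
    · subst hj; simp
    · rw [Pi.single_eq_of_ne hj]; norm_num
  have b7 : InBox13 (liftPt i y) := fun j => by
    by_cases hj : j = i
    · subst hj; simp [liftPt]
    · rw [(liftPt_spec i y).1 j hj]; exact hy j
  have b8 : InBox13 y := hy
  have l4 := (gadgetLen_bounds i).2
  unfold m7 m6 m5 m4 m3 m2 m1
  have := dist1_le_of_inBox b1 b2; have := dist1_le_of_inBox b2 b3; have := dist1_le_of_inBox b3 b4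
  have := dist1_le_of_inBox b5 b6; have := dist1_le_of_inBox b6 b7; have := dist1_le_of_inBox b7 b8
  nlinarith

end RouteOcc

/-! ### The routing theorem -/

section Routing

variable {d : ℕ}

/-- **Routing theorem.** Let `B = c + [-13, 13]^{d+2}` and let `x ≠ y` be two points of its outer
layer (`‖x - c‖∞ = ‖y - c‖∞ = 13`). Then there is a self-avoiding nearest-neighbour path `π`
inside `B` from `x` to `y`, of length at most `156 (d+2) + 56`, on which `(V, Q)` occurs
cleanly at some step `k` — `π(k + s) = π(k) + v(s)` for `s ≤ 11` and no other point of `π`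
lies in the cube `Q + π(k)` — with this cube inside `c + [-12, 12]^{d+2}`. (Used to rewire a
self-avoiding walk inside a cube which it covers, cf. Madras–Slade Lemma 7.2.4(b); the path runs
down from `x` to a face, to the face centre, along the axis through an explicit planar gadget
carrying `V` and `V` reversed, and symmetrically up to `y`; for `xᵢ > yᵢ` the reversed path is
used.) [cite: MadrasSlade1993, Lemma 7.2.4(b)] -/
theorem exists_route (c x y : Site (d + 2)) (hx : ∀ j, |x j - c j| ≤ 13) (hxL : ∃ j, |x j - c j| = 13)
    (hy : ∀ j, |y j - c j| ≤ 13) (hyL : ∃ j, |y j - c j| = 13) (hne : x ≠ y) :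
    ∃ (L : ℕ) (π : ℕ → Site (d + 2)), L ≤ 156 * (d + 2) + 56 ∧ π 0 = x ∧ π L = y ∧ PathOn L π ∧
      (∀ t ≤ L, ∀ j, |π t j - c j| ≤ 13) ∧
      ∃ k, k + 11 ≤ L ∧ (∀ s ≤ 11, π (k + s) = π k + vPt s) ∧
        (∀ t ≤ L, (t < k ∨ k + 11 < t) → ¬ InCube (π k) (π t)) ∧
        (∀ z, InCube (π k) z → ∀ j, |z j - c j| ≤ 12) := by
  -- translate to the origin
  set x' : Site (d + 2) := x - c with hx'
  set y' : Site (d + 2) := y - c with hy'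
  have hx1 : ∀ j, |x' j| ≤ 13 := fun j => by simpa [hx'] using hx j
  have hx2 : ∃ j, |x' j| = 13 := by simpa [hx'] using hxL
  have hy1 : ∀ j, |y' j| ≤ 13 := fun j => by simpa [hy'] using hy j
  have hy2 : ∃ j, |y' j| = 13 := by simpa [hy'] using hyL
  have hne' : x' ≠ y' := fun h => hne (by simpa [hx', hy'] using congrArg (· + c) h)
  obtain ⟨i, hi⟩ : ∃ i, x' i ≠ y' i := by
    by_contra h; push Not at h; exact hne' (funext h)
  -- common packaging of an origin-based route `ρ` into the translated statement
  have pack : ∀ (L : ℕ) (ρ : ℕ → Site (d + 2)), L ≤ 156 * (d + 2) + 56 → ρ 0 = x' → ρ L = y' →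
      PathOn L ρ → (∀ t ≤ L, InBox13 (ρ t)) →
      (∃ k, k + 11 ≤ L ∧ (∀ s ≤ 11, ρ (k + s) = ρ k + vPt s) ∧
        (∀ t ≤ L, (t < k ∨ k + 11 < t) → ¬ InCube (ρ k) (ρ t)) ∧
        (∀ z, InCube (ρ k) z → ∀ j, |z j| ≤ 12)) →
      ∃ (L : ℕ) (π : ℕ → Site (d + 2)), L ≤ 156 * (d + 2) + 56 ∧ π 0 = x ∧ π L = y ∧ PathOn L π ∧
        (∀ t ≤ L, ∀ j, |π t j - c j| ≤ 13) ∧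
        ∃ k, k + 11 ≤ L ∧ (∀ s ≤ 11, π (k + s) = π k + vPt s) ∧
          (∀ t ≤ L, (t < k ∨ k + 11 < t) → ¬ InCube (π k) (π t)) ∧
          (∀ z, InCube (π k) z → ∀ j, |z j - c j| ≤ 12) := by
    intro L ρ hL h0 hend hP hbox ⟨k, hk, hseg, havoid, hcube⟩
    refine ⟨L, fun t => c + ρ t, hL, by simp [h0, hx'], by simp [hend, hy'], hP.add_const c,
      fun t ht j => by simpa using hbox t ht j, k, hk, fun s hs => by
        show c + ρ (k + s) = c + ρ k + vPt s
        rw [hseg s hs, add_assoc],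
      fun t ht hout => ?_, fun z hz j => ?_⟩
    · intro h
      apply havoid t ht hout
      intro j'; have := h j'; simpa using this
    · have : InCube (ρ k) (z - c) := fun j' => by have := hz j'; simp at this ⊢; constructor <;> linarith [this.1, this.2]
      simpa using hcube (z - c) this j
  rcases lt_or_gt_of_ne hi with hlt | hlt
  · -- `x'ᵢ < y'ᵢ`: the route upwards
    obtain ⟨hP, h0, hend, hpts⟩ := A7_spec hx1 hx2 hy1 hy2 hlt
    obtain ⟨hk, hseg, havoid, hcube⟩ := A7_occV hx1 hx2 hy1 hy2 hlt
    exact pack _ _ (m7_le hx1 hy1) h0 hend hP (fun t ht => (hpts t ht).2)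
      ⟨_, hk, hseg, havoid, hcube⟩
  · -- `x'ᵢ > y'ᵢ`: the route upwards from `y'` to `x'`, reversed
    obtain ⟨hP, h0, hend, hpts⟩ := A7_spec hy1 hy2 hx1 hx2 hlt
    obtain ⟨hk, hseg, havoid, hcube⟩ := A7_occVrev hy1 hy2 hx1 hx2 hlt
    obtain ⟨hcorner, hseg', havoid'⟩ := occ_of_rev hk hseg havoid
    refine pack (m7 i y' x') (preverse (m7 i y' x') (A7 i y' x')) (m7_le hy1 hx1)
      (by simp [preverse, hend]) (by simp [preverse, h0]) hP.reverse
      (fun t ht => by simp only [preverse]; exact (hpts _ (by omega)).2)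
      ⟨m7 i y' x' - (m3 i y' + gadgetKR i + 11), by omega, hseg', havoid', fun z hz => ?_⟩
    rw [hcorner] at hz
    exact hcube z hz

end Routing

end Literature.Probability.RandomPlanarGeometry.SAW.Zd
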